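import Mathlib
import Literature.Algebra.Polynomial.PadicRootProductNorms
import HarnessLib

/-!
# Rigidity of `p`-adic root multiplicities under a polynomial kernel bound
# (an intersection-theory-free route to the integrality and `ℓ`-independence of the
# characteristic polynomial of Frobenius)

Topic `Literature/Algebra/Polynomial`; **proof file** (theorems, four small auxiliary definitions
`height`, `kerNorm`, `ofCoeffs`, `redMod`, `rts` and the hypothesis bundle `IsGoodFamily`; no named facts,
D-0014/D-0026).  Sibling of `PadicRootProductNorms` (Milne's Lemma 12.10), whose `p`-adic root
bookkeeping it reuses.

## The theorems

Let `m_j ∈ ℤ[X]` (`j ∈ J`, finite) be monic, irreducible and pairwise distinct (`IsGoodFamily m`), and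
for an integer polynomial `F` write `H(F) = maxᵢ |Fᵢ|` (`height F`).  For a prime `p` and a monic
`Q ∈ ℤ_p[X]` put `kerNorm Q F = ∏_{Q(b) = 0} |F(b)|_p⁻¹`, the product over the roots `b` of `Q` in
`\overline{ℚ_p}` with multiplicity.  (When `Q` is the characteristic polynomial of an endomorphism `π` of a
free `ℤ_p`-module `T` of finite rank, `kerNorm Q F = |det F(π)|_p⁻¹` is the order of the kernel of `F(π)`
on `T ⊗ ℚ_p/ℤ_p`; for the `p`-adic Tate module of an abelian variety this is the `p`-primary part of
`#Ker F(π)(k̄)`.)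

* `IsGoodFamily.eq_prod_pow_of_kerNorm_le` (**one prime**).  If all roots of `Q` are roots of the
  `m_j` and, for every degree budget `r`, `kerNorm Q F ≤ C(r) · H(F)^{deg Q}` for all `F ∈ ℤ[X]` of
  degree `< r` divisible by no `m_j`, then `Q = ∏_j m_j^{n_j}` for some `n_j ≥ 0`: every root of `m_j` has
  one and the same multiplicity in `Q`, and `Q` has integer coefficients.
* `IsGoodFamily.rootMultiplicity_le_of_kerNorm_mul_le`, `IsGoodFamily.eq_prod_pow_of_kerNorm_mul_le`
  (**two primes**).  If `Q' ∈ ℤ_q[X]` is monic with roots among the roots of the `m_j`, and the JOINT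
  bound `kerNorm_p(∏ m_j^{n_j}, F) · kerNorm_q(Q', F) ≤ C(r) · H(F)^N`, `N = ∑ n_j deg m_j`, holds for the
  same test polynomials, then every root of `m_j` has multiplicity `≤ n_j` in `Q'`; if `deg Q' = N`, then
  `Q' = ∏_j m_j^{n_j}` as well.

## Where it is used

For an abelian variety `A` over a finite field with Frobenius `π`, an integer polynomial `m` killing `π`
(`End A` is finitely generated), its distinct irreducible factors `m_j`, and `Q_ℓ` the characteristic
polynomial of `T_ℓ(π)`: the kernel bound is `#Ker F(π)(k̄) ≤ deg F(π) ≤ C · (∑ |Fᵢ|)^{2 dim A}`, the degree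
bound from the theorem of the cube (`Motives/AbelianVarietyEndDegreeBound`), and `#Ker F(π)(k̄)` is the
product over all primes `ℓ` of `kerNorm Q_ℓ F` (`EllipticCurves/TateModuleKernelIndexProofs`).  The two
theorems then give `Q_ℓ = P ∈ ℤ[X]` for all `ℓ ≠ char`, and domination of the `p`-adic étale
multiplicities — Weil's theorem "`charpoly (π | T_ℓ A)` has integer coefficients independent of `ℓ`"
(Mumford §19 Thm. 4 with §21; Milne 1986 Thm. 19.1 (a)) WITHOUT Mumford §19 Thm. 2 (polynomiality of
`deg` on `End A`, i.e. intersection theory), which the tree does not have.  (Planned consumer: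
`Motives/AbelianVarietyFrobeniusCharpolyRigidity`, towards
`Literature.NumberTheory.GaloisRepresentations.picardCurve_exists_lambdaAdicRep`.)

## Proof (this file's own route; elementary)

Fix a prime `p` and let `μ_j` be the maximal multiplicity in `Q` of a root of `m_j`; all
`ℚ_p`-conjugates of a root have the same multiplicity (`PadicRootProductNorms`), so `μ_j` is attained on
all `e_j` roots of an irreducible factor `g_j` of `m_j` over `ℤ_p`.
1. PIGEONHOLE (`exists_small_deep`): among the `(p^u + 1)^{d_j}` integer polynomials of degree `< d_j`
   (`d_j = deg m_j`) with coefficients in `[0, p^u]` two agree modulo `(g_j, p^t)` as soon as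
   `p^{t e_j} ≤ p^{u d_j}`; their difference `F_j ≠ 0` has height `≤ p^u` and `|F_j(θ)|_p ≤ p^{-t}` on the
   roots of `g_j` (`norm_aeval_le_of_modByMonic_eq`).
2. CRT (`exists_glue`): Bézout for the coprime `m_j`, `∏_{i ≠ j} m_i` in `ℚ[X]` and clearing denominators
   give integer polynomials `B_j ≡ ρ_j mod m_j`, `≡ 0 mod m_i`; then `F = ∑ B_j F_j` has
   `F(θ) = ρ_j F_j(θ)` on the roots of `m_j`, bounded degree, height `≤ C_m max H(F_j)`, and `m_j ∤ F`.
3. COMPARISON (`sum_sup_mul_natDegree_le`): `F` vanishes at no root (degrees), the factors of `kerNorm`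
   are `≥ 1` (integrality), so with `t_j e_j = u d_j`:
   `p^{u ∑ μ_j d_j} ≤ kerNorm Q F ≤ C H(F)^{deg Q} ≤ C' p^{u deg Q}` for all `u`, whence
   `∑ μ_j d_j ≤ deg Q`.  But `deg Q ≤ ∑ μ_j d_j` trivially (`natDegree_le_sum_sup`), so equality holds
   root by root and `Q = ∏ m_j^{μ_j}` (`eq_prod_pow_of_roots_eq`).
4. TWO PRIMES: serving `j₀` at the prime `q` (depth `q^{t₀ e₀} ≈ p^{u d_{j₀}}`, `Nat.log`) and the other `j`
   at `p` gives `∑_{j ≠ j₀} n_j d_j + c d_{j₀} ≤ N = ∑ n_j d_j` for the multiplicity `c` in `Q'` of a root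
   of `m_{j₀}`, i.e. `c ≤ n_{j₀}`.

## References (for the statements proved about Frobenius downstream; the route here is not in them)

* D. Mumford, *Abelian Varieties*, TIFR Studies in Mathematics 5 (1970): §19, Thm. 4 ("`P` has integral
  coefficients … independent of `ℓ`"), §21. [MumfordAV1970]
* J. S. Milne, *Abelian Varieties*, in Cornell–Silverman (eds.), *Arithmetic Geometry* (1986): §12,
  Prop. 12.9, Lemma 12.10; §19, Thm. 19.1 (a) (held: `book:cornellnd-arithmetic-geometry`).
  [Milne1986AbelianVarieties]
* A. Weil, *Variétés abéliennes et courbes algébriques*, Hermann (1948), no. 68–71. [Weil1948]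

## Design notes

* Roots live in Mathlib's `PadicAlgCl p = \overline{ℚ_p}` with its spectral norm; integrality of roots of
  monic `ℤ_p`-polynomials and the conjugacy of multiplicities come from `PadicRootProductNorms`.
* The kernel bound is assumed for EVERY degree budget `r` (with a constant depending on `r`), so that the
  glued test polynomial need not be reduced modulo `∏ m_j`; the consumer supplies it from the cube bound for
  the family `π^0, …, π^{r-1}`.
* Mathlib searched/used: `Fintype.exists_ne_map_eq_of_card_lt` (pigeonhole), `PadicInt.ker_toZModPow`,
  `Polynomial.modByMonic_add_div`, `natDegree_modByMonic_lt`, `IsLocalization.integerNormalization_spec`,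
  `Irreducible.coprime_iff_not_dvd`, `IsCoprime.prod_right`, `Monic.irreducible_iff_irreducible_map_fraction_map`
  (Gauss), `map_dvd_map`, `minpoly.isIntegrallyClosed_dvd`, `minpoly.eq_of_irreducible_of_monic`,
  `minpoly.degree_le_of_ne_zero`, `Splits.eq_prod_roots_of_monic`, `roots_prod`, `roots_pow`, `Nat.log`
  (`Nat.pow_log_le_self`, `Nat.lt_pow_succ_log_self`), `pow_unbounded_of_one_lt`.  Mathlib has no statement
  of this kind (searched `rootMultiplicity` ∧ `charpoly`, `integerNormalization` ∧ `minpoly`).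
-/

noncomputable section

open Polynomial
open scoped Classical

namespace Literature.Algebra.Polynomial

namespace RootRigidity

variable {p : ℕ} [Fact p.Prime]

/-! ### Height of an integer polynomial -/

/-- The naive height `H(F) = maxᵢ |Fᵢ|` of an integer polynomial. [folklore] -/
def height (F : ℤ[X]) : ℕ := (Finset.range (F.natDegree + 1)).sup fun i => (F.coeff i).natAbs

/-- Each coefficient is bounded by the height. [folklore] -/
theorem natAbs_coeff_le_height (F : ℤ[X]) (i : ℕ) : (F.coeff i).natAbs ≤ height F := by
  by_cases hi : i ≤ F.natDegree
  · exact Finset.le_sup (f := fun i => (F.coeff i).natAbs) (Finset.mem_range.2 (Nat.lt_succ_of_le hi))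
  · rw [coeff_eq_zero_of_natDegree_lt (not_le.1 hi)]; simp

/-- A uniform bound on the coefficients bounds the height. [folklore] -/
theorem height_le_of_forall_le {F : ℤ[X]} {B : ℕ} (h : ∀ i, (F.coeff i).natAbs ≤ B) : height F ≤ B :=
  Finset.sup_le fun i _ => h i

/-! ### The kernel norm `∏ |F(b)|⁻¹` over the roots of a `p`-adic polynomial -/

/-- `kerNorm Q F = ∏_{Q(b) = 0} |F(b)|_p⁻¹`, the product over the roots `b` of `Q ∈ ℤ_p[X]` in
`\overline{ℚ_p}` counted with multiplicity (for `Q` the characteristic polynomial of an endomorphism `π`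
of a free `ℤ_p`-module `T` this is `|det F(π | T)|_p⁻¹`, the order of the `p`-primary part of the
kernel of `F(π)` on `T ⊗ ℚ_p/ℤ_p`). [folklore] -/
def kerNorm (Q : ℤ_[p][X]) (F : ℤ[X]) : ℝ :=
  ((Q.map (algebraMap ℤ_[p] (PadicAlgCl p))).roots.map fun b => ‖aeval b F‖⁻¹).prod

/-! ### Small integer polynomials that are `p`-adically deep on the roots of a factor (pigeonhole) -/

/-- The integer polynomial `∑_{i<D} cᵢ Xⁱ` with coefficient vector `c`. [folklore] -/
def ofCoeffs {D : ℕ} (c : Fin D → ℤ) : ℤ[X] := ∑ i : Fin D, C (c i) * X ^ (i : ℕ)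

/-- The coefficients of `ofCoeffs c` below `D` are the `cᵢ`. [folklore] -/
theorem coeff_ofCoeffs_of_lt {D : ℕ} (c : Fin D → ℤ) {i : ℕ} (hi : i < D) :
    (ofCoeffs c).coeff i = c ⟨i, hi⟩ := by
  simp only [ofCoeffs, finsetSum_coeff, coeff_C_mul, coeff_X_pow]
  rw [Finset.sum_eq_single ⟨i, hi⟩]
  · simp
  · intro j _ hj
    rw [if_neg, mul_zero]
    intro hij
    exact hj (Fin.ext hij.symm)
  · intro h'
    exact absurd (Finset.mem_univ _) h'

/-- The coefficients of `ofCoeffs c` vanish from `D` on. [folklore] -/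
theorem coeff_ofCoeffs_of_le {D : ℕ} (c : Fin D → ℤ) {i : ℕ} (hi : D ≤ i) : (ofCoeffs c).coeff i = 0 := by
  simp only [ofCoeffs, finsetSum_coeff, coeff_C_mul, coeff_X_pow]
  refine Finset.sum_eq_zero fun j _ => ?_
  rw [if_neg, mul_zero]
  intro hij
  have := j.2
  omega

/-- `ofCoeffs` is additive. [folklore] -/
theorem ofCoeffs_sub {D : ℕ} (c c' : Fin D → ℤ) : ofCoeffs (c - c') = ofCoeffs c - ofCoeffs c' := by
  simp only [ofCoeffs, Pi.sub_apply, C_sub, sub_mul, Finset.sum_sub_distrib]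

/-- `deg (ofCoeffs c) < D`. [folklore] -/
theorem degree_ofCoeffs_lt {D : ℕ} (c : Fin D → ℤ) : (ofCoeffs c).degree < D :=
  degree_sum_fin_lt c

/-- The coefficientwise reduction of `F mod g` modulo `p^t` (for `g` monic over `ℤ_p`). [folklore] -/
def redMod (g : ℤ_[p][X]) (t : ℕ) (F : ℤ[X]) : Fin g.natDegree → ZMod (p ^ t) :=
  fun i => PadicInt.toZModPow t ((F.map (Int.castRingHom ℤ_[p]) %ₘ g).coeff i)

/-- If two integer polynomials have the same reduction, their difference is `≡ 0 mod (g, p^t)`: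
`(F - F') mod g = p^t · H` for some `H ∈ ℤ_p[X]`. [folklore] -/
theorem exists_modByMonic_eq_of_redMod_eq {g : ℤ_[p][X]} (hg : g.Monic) (hg1 : 0 < g.natDegree) {t : ℕ}
    {F F' : ℤ[X]} (h : redMod g t F = redMod g t F') :
    ∃ H : ℤ_[p][X], (F - F').map (Int.castRingHom ℤ_[p]) %ₘ g = C ((p : ℤ_[p]) ^ t) * H := by
  set R := (F - F').map (Int.castRingHom ℤ_[p]) %ₘ g with hR
  have hRcoeff : ∀ i : Fin g.natDegree, ∃ a : ℤ_[p], R.coeff i = (p : ℤ_[p]) ^ t * a := by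
    intro i
    have hi := congrFun h i
    simp only [redMod] at hi
    have hmem : R.coeff i ∈ RingHom.ker (PadicInt.toZModPow (p := p) t) := by
      rw [RingHom.mem_ker, hR, Polynomial.map_sub, sub_modByMonic, coeff_sub, map_sub, hi, sub_self]
    rw [PadicInt.ker_toZModPow, Ideal.mem_span_singleton] at hmem
    obtain ⟨a, ha⟩ := hmem
    exact ⟨a, ha⟩
  choose a ha using hRcoeff
  refine ⟨∑ i : Fin g.natDegree, C (a i) * X ^ (i : ℕ), ?_⟩
  have hg1' : g ≠ 1 := by
    rintro rfl
    simp at hg1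
  have hRdeg : R.natDegree < g.natDegree := natDegree_modByMonic_lt _ hg hg1'
  ext i
  rw [coeff_C_mul, finsetSum_coeff]
  by_cases hi : i < g.natDegree
  · rw [ha ⟨i, hi⟩]
    congr 1
    simp only [coeff_C_mul, coeff_X_pow]
    rw [Finset.sum_eq_single ⟨i, hi⟩]
    · simp
    · intro j _ hj
      rw [if_neg, mul_zero]
      intro hij
      exact hj (Fin.ext hij.symm)
    · intro h'
      exact absurd (Finset.mem_univ _) h'
  · rw [coeff_eq_zero_of_natDegree_lt (lt_of_lt_of_le hRdeg (not_lt.1 hi))]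
    rw [Finset.sum_eq_zero, mul_zero]
    intro j _
    simp only [coeff_C_mul, coeff_X_pow]
    rw [if_neg, mul_zero]
    intro hij
    have := j.2
    omega

/-- **Pigeonhole.** For `g ∈ ℤ_p[X]` monic of degree `e ≥ 1`, `D ≥ e`... (`D ≥ 1`) and `t e ≤ u D`, there is a
nonzero integer polynomial `F` of degree `< D` and height `≤ p^u` with `F mod g ≡ 0 mod p^t`: the
`(p^u + 1)^D > p^{uD} ≥ p^{te} = #(ℤ_p[X]/(g, p^t))` polynomials with coefficients in `[0, p^u]` cannot
have distinct reductions. [folklore] -/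
theorem exists_small_deep {g : ℤ_[p][X]} (hg : g.Monic) (hg1 : 0 < g.natDegree) {D u t : ℕ}
    (hD0 : 0 < D) (htu : t * g.natDegree ≤ u * D) :
    ∃ F : ℤ[X], F ≠ 0 ∧ F.natDegree < D ∧ height F ≤ p ^ u ∧
      ∃ H : ℤ_[p][X], F.map (Int.castRingHom ℤ_[p]) %ₘ g = C ((p : ℤ_[p]) ^ t) * H := by
  have hp : p.Prime := Fact.out
  haveI : NeZero (p ^ t) := ⟨pow_ne_zero _ hp.ne_zero⟩
  let f : (Fin D → Fin (p ^ u + 1)) → (Fin g.natDegree → ZMod (p ^ t)) :=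
    fun c => redMod g t (ofCoeffs fun i => ((c i : ℕ) : ℤ))
  have hcard : Fintype.card (Fin g.natDegree → ZMod (p ^ t)) < Fintype.card (Fin D → Fin (p ^ u + 1)) := by
    simp only [Fintype.card_fun, ZMod.card, Fintype.card_fin]
    calc (p ^ t) ^ g.natDegree = p ^ (t * g.natDegree) := by rw [pow_mul]
      _ ≤ p ^ (u * D) := Nat.pow_le_pow_right hp.pos htu
      _ = (p ^ u) ^ D := by rw [pow_mul]
      _ < (p ^ u + 1) ^ D := Nat.pow_lt_pow_left (Nat.lt_succ_self _) hD0.ne'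
  obtain ⟨c, c', hne, heq⟩ := Fintype.exists_ne_map_eq_of_card_lt f hcard
  set F := ofCoeffs (fun i => ((c i : ℕ) : ℤ)) - ofCoeffs (fun i => ((c' i : ℕ) : ℤ)) with hF
  have hFc : ∀ i : Fin D, F.coeff i = ((c i : ℕ) : ℤ) - ((c' i : ℕ) : ℤ) := fun i => by
    rw [hF, coeff_sub, coeff_ofCoeffs_of_lt _ i.2, coeff_ofCoeffs_of_lt _ i.2]
  have hF0 : F ≠ 0 := by
    intro h0
    apply hne
    funext i
    have hi := hFc i
    rw [h0, coeff_zero] at hi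
    have : (c i : ℕ) = (c' i : ℕ) := by omega
    exact Fin.ext this
  refine ⟨F, hF0, ?_, ?_, ?_⟩
  · have hdeg : F.degree < D := by
      rw [hF]
      refine lt_of_le_of_lt (degree_sub_le _ _) (max_lt (degree_ofCoeffs_lt _) (degree_ofCoeffs_lt _))
    exact (natDegree_lt_iff_degree_lt hF0).2 hdeg
  · refine height_le_of_forall_le fun i => ?_
    by_cases hi : i < D
    · rw [hFc ⟨i, hi⟩]
      have h1 : ((c ⟨i, hi⟩ : ℕ)) ≤ p ^ u := Nat.lt_succ_iff.1 (c ⟨i, hi⟩).2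
      have h2 : ((c' ⟨i, hi⟩ : ℕ)) ≤ p ^ u := Nat.lt_succ_iff.1 (c' ⟨i, hi⟩).2
      omega
    · rw [hF, coeff_sub, coeff_ofCoeffs_of_le _ (not_lt.1 hi), coeff_ofCoeffs_of_le _ (not_lt.1 hi)]
      simp
  · rw [hF]
    exact exists_modByMonic_eq_of_redMod_eq hg hg1 heq

/-- `aeval θ F`, for an integer polynomial `F`, computed through `ℤ → ℤ_p → \overline{ℚ_p}`. [folklore] -/
theorem aeval_eq_eval_map_map (F : ℤ[X]) (θ : PadicAlgCl p) :
    aeval θ F = ((F.map (Int.castRingHom ℤ_[p])).map (algebraMap ℤ_[p] (PadicAlgCl p))).eval θ := by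
  rw [Polynomial.map_map, eval_map, aeval_def, RingHom.ext_int (algebraMap ℤ (PadicAlgCl p))
    ((algebraMap ℤ_[p] (PadicAlgCl p)).comp (Int.castRingHom ℤ_[p]))]

/-- `|F(b)| ≤ 1` for an integer polynomial `F` and `|b| ≤ 1`. [folklore] -/
theorem norm_aeval_le_one (F : ℤ[X]) {b : PadicAlgCl p} (hb : ‖b‖ ≤ 1) : ‖aeval b F‖ ≤ 1 := by
  rw [aeval_eq_eval_map_map]
  exact PadicInt.norm_eval_map_le_of_coeff_le zero_le_one (fun j => _root_.PadicInt.norm_le_one _) hb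

/-- `|n| ≤ 1` in `\overline{ℚ_p}` for an integer `n`. [folklore] -/
private theorem norm_intCast_le_one (n : ℤ) : ‖(n : PadicAlgCl p)‖ ≤ 1 := by
  rw [← map_intCast (algebraMap ℤ_[p] (PadicAlgCl p)), PadicInt.norm_algebraMap_padicAlgCl]
  exact _root_.PadicInt.norm_le_one _

/-- **Depth on the roots.** If `F mod g = p^t · H` in `ℤ_p[X]`, then `|F(θ)| ≤ p^{-t}` at every root
`θ ∈ \overline{ℚ_p}` of `g` (as `F(θ) = p^t H(θ)` and `|H(θ)| ≤ 1`, `θ` being integral). [folklore] -/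
theorem norm_aeval_le_of_modByMonic_eq {g : ℤ_[p][X]} (hg : g.Monic) {F : ℤ[X]} {t : ℕ} {H : ℤ_[p][X]}
    (hH : F.map (Int.castRingHom ℤ_[p]) %ₘ g = C ((p : ℤ_[p]) ^ t) * H) {θ : PadicAlgCl p}
    (hθ : aeval θ g = 0) : ‖aeval θ F‖ ≤ (p : ℝ) ^ (-(t : ℤ)) := by
  have hθ' : (g.map (algebraMap ℤ_[p] (PadicAlgCl p))).eval θ = 0 := by rwa [eval_map_algebraMap]
  have hdiv := modByMonic_add_div (F.map (Int.castRingHom ℤ_[p])) g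
  rw [aeval_eq_eval_map_map, ← hdiv, hH, Polynomial.map_add, Polynomial.map_mul, Polynomial.map_mul,
    Polynomial.map_C, eval_add, eval_mul, eval_mul, eval_C, hθ', zero_mul, add_zero, norm_mul,
    PadicInt.norm_algebraMap_pow]
  have hθ1 : ‖θ‖ ≤ 1 := PadicInt.norm_le_one_of_eval_map_eq_zero hg hθ'
  have hH1 : ‖(H.map (algebraMap ℤ_[p] (PadicAlgCl p))).eval θ‖ ≤ 1 :=
    PadicInt.norm_eval_map_le_of_coeff_le zero_le_one (fun j => _root_.PadicInt.norm_le_one _) hθ1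
  calc (p : ℝ) ^ (-(t : ℤ)) * ‖(H.map (algebraMap ℤ_[p] (PadicAlgCl p))).eval θ‖
      ≤ (p : ℝ) ^ (-(t : ℤ)) * 1 := mul_le_mul_of_nonneg_left hH1 (PadicInt.zpow_neg_natCast_pos t).le
    _ = (p : ℝ) ^ (-(t : ℤ)) := mul_one _

/-! ### Products of reals over multisets -/

/-- A product of nonnegative reals is nonnegative. [folklore] -/
private theorem prod_map_nonneg {α : Type*} (s : Multiset α) {f : α → ℝ} (h : ∀ x ∈ s, 0 ≤ f x) :
    0 ≤ (s.map f).prod := by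
  induction s using Multiset.induction_on with
  | empty => simp
  | cons a s ih =>
    rw [Multiset.map_cons, Multiset.prod_cons]
    exact mul_nonneg (h a (Multiset.mem_cons_self a s)) (ih fun x hx => h x (Multiset.mem_cons_of_mem hx))

/-- A product of reals `≥ 1` is `≥ 1`. [folklore] -/
private theorem one_le_prod_map {α : Type*} (s : Multiset α) {f : α → ℝ} (h : ∀ x ∈ s, 1 ≤ f x) :
    1 ≤ (s.map f).prod := by
  induction s using Multiset.induction_on with
  | empty => simp
  | cons a s ih =>
    rw [Multiset.map_cons, Multiset.prod_cons]
    exact one_le_mul_of_one_le_of_one_le (h a (Multiset.mem_cons_self a s))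
      (ih fun x hx => h x (Multiset.mem_cons_of_mem hx))

/-- A product of reals `≥ a ≥ 0` is `≥ a^{card}`. [folklore] -/
theorem pow_card_le_prod_map {α : Type*} (s : Multiset α) {f : α → ℝ} {a : ℝ} (ha : 0 ≤ a)
    (h : ∀ x ∈ s, a ≤ f x) : a ^ Multiset.card s ≤ (s.map f).prod := by
  induction s using Multiset.induction_on with
  | empty => simp
  | cons b s ih =>
    rw [Multiset.map_cons, Multiset.prod_cons, Multiset.card_cons, pow_succ']
    have ih' := ih fun x hx => h x (Multiset.mem_cons_of_mem hx)
    exact mul_le_mul (h b (Multiset.mem_cons_self b s)) ih' (pow_nonneg ha _)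
      (ha.trans (h b (Multiset.mem_cons_self b s)))

/-- Sub-products bound the kernel norm from below: for `T ≤ roots(Q)` (multisets) and `F` non-vanishing on
the roots of the monic `Q`, `∏_{b ∈ T} |F(b)|⁻¹ ≤ kerNorm Q F` (the omitted factors are `≥ 1`).
[folklore] -/
theorem prod_le_kerNorm {Q : ℤ_[p][X]} (hQ : Q.Monic) {F : ℤ[X]}
    (hF : ∀ b ∈ (Q.map (algebraMap ℤ_[p] (PadicAlgCl p))).roots, aeval b F ≠ 0)
    {T : Multiset (PadicAlgCl p)} (hT : T ≤ (Q.map (algebraMap ℤ_[p] (PadicAlgCl p))).roots) :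
    (T.map fun b => ‖aeval b F‖⁻¹).prod ≤ kerNorm Q F := by
  obtain ⟨U, hU⟩ := Multiset.le_iff_exists_add.1 hT
  rw [kerNorm, hU, Multiset.map_add, Multiset.prod_add]
  have hU1 : 1 ≤ (U.map fun b => ‖aeval b F‖⁻¹).prod := by
    refine one_le_prod_map U fun b hb => ?_
    have hb' : b ∈ (Q.map (algebraMap ℤ_[p] (PadicAlgCl p))).roots := by
      rw [hU]; exact Multiset.mem_add.2 (Or.inr hb)
    have h1 : ‖aeval b F‖ ≤ 1 := norm_aeval_le_one F (PadicInt.norm_le_one_of_mem_roots_map hQ hb')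
    have h2 : 0 < ‖aeval b F‖ := norm_pos_iff.2 (hF b hb')
    exact (one_le_inv₀ h2).2 h1
  have hT0 : 0 ≤ (T.map fun b => ‖aeval b F‖⁻¹).prod :=
    prod_map_nonneg T fun b _ => inv_nonneg.2 (norm_nonneg _)
  calc (T.map fun b => ‖aeval b F‖⁻¹).prod = (T.map fun b => ‖aeval b F‖⁻¹).prod * 1 := (mul_one _).symm
    _ ≤ _ := mul_le_mul_of_nonneg_left hU1 hT0

/-- A multiset `∑ μ_j • S_j` built from pairwise disjoint `Nodup` multisets `S_j` lies below `R` as soon as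
every element of `S_j` has multiplicity `≥ μ_j` in `R`. [folklore] -/
theorem sum_nsmul_le {α : Type*} [DecidableEq α] {J : Type*} [Fintype J] {S : J → Multiset α} {R : Multiset α}
    {μ : J → ℕ} (hnd : ∀ j, (S j).Nodup) (hdisj : ∀ i j b, b ∈ S i → b ∈ S j → i = j)
    (hle : ∀ j, ∀ b ∈ S j, μ j ≤ R.count b) : ∑ j, μ j • S j ≤ R := by
  rw [Multiset.le_iff_count]
  intro b
  rw [Multiset.count_sum']
  simp only [Multiset.count_nsmul]
  by_cases hb : ∃ j, b ∈ S j
  · obtain ⟨j, hj⟩ := hb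
    rw [Finset.sum_eq_single j]
    · rw [Multiset.count_eq_one_of_mem (hnd j) hj, mul_one]; exact hle j b hj
    · intro i _ hij
      rw [Multiset.count_eq_zero_of_notMem, mul_zero]
      exact fun hi => hij (hdisj i j b hi hj)
    · intro h; exact absurd (Finset.mem_univ j) h
  · push Not at hb
    rw [Finset.sum_eq_zero fun j _ => by rw [Multiset.count_eq_zero_of_notMem (hb j), mul_zero]]
    exact Nat.zero_le _

/-- If `x^{ka} ≤ K x^{kb}` for all `k ≥ 1` (`x > 1`), then `a ≤ b`. [folklore] -/
theorem nat_le_of_forall_pow_le {x : ℝ} (hx : 1 < x) {a b : ℕ} {K : ℝ}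
    (h : ∀ k : ℕ, 0 < k → x ^ (k * a) ≤ K * x ^ (k * b)) : a ≤ b := by
  by_contra hab
  push Not at hab
  obtain ⟨n, hn⟩ := pow_unbounded_of_one_lt K hx
  have hk := h (n + 1) (Nat.succ_pos n)
  have hx0 : 0 < x := lt_trans zero_lt_one hx
  have h1 : x ^ ((n + 1) * a) = x ^ ((n + 1) * b) * x ^ ((n + 1) * (a - b)) := by
    rw [← pow_add]; congr 1
    rw [← Nat.mul_add]; congr 1; omega
  have h2 : x ^ n < x ^ ((n + 1) * (a - b)) := by
    refine pow_lt_pow_right₀ hx ?_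
    have : 1 ≤ a - b := by omega
    nlinarith
  have h3 : K * x ^ ((n + 1) * b) < x ^ ((n + 1) * a) := by
    rw [h1, mul_comm (x ^ ((n + 1) * b))]
    exact mul_lt_mul_of_pos_right (hn.trans h2) (pow_pos hx0 _)
  exact absurd hk (not_le.2 h3)

/-! ### Height arithmetic -/

/-- `H(0) = 0`. [folklore] -/
theorem height_zero : height (0 : ℤ[X]) = 0 := by
  apply le_antisymm _ (Nat.zero_le _)
  exact height_le_of_forall_le fun i => by simp

/-- `H(A + B) ≤ H(A) + H(B)`. [folklore] -/
theorem height_add_le (A B : ℤ[X]) : height (A + B) ≤ height A + height B := by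
  refine height_le_of_forall_le fun i => ?_
  rw [coeff_add]
  exact (Int.natAbs_add_le _ _).trans (add_le_add (natAbs_coeff_le_height A i) (natAbs_coeff_le_height B i))

/-- `H(∑ Aᵢ) ≤ ∑ H(Aᵢ)`. [folklore] -/
theorem height_sum_le {ι : Type*} (s : Finset ι) (A : ι → ℤ[X]) :
    height (∑ i ∈ s, A i) ≤ ∑ i ∈ s, height (A i) := by
  induction s using Finset.induction_on with
  | empty => simp [height_zero]
  | insert a s ha ih =>
    rw [Finset.sum_insert ha, Finset.sum_insert ha]
    exact (height_add_le _ _).trans (Nat.add_le_add_left ih _)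

/-- `H(A B) ≤ (deg A + deg B + 1) H(A) H(B)`. [folklore] -/
theorem height_mul_le (A B : ℤ[X]) :
    height (A * B) ≤ (A.natDegree + B.natDegree + 1) * height A * height B := by
  refine height_le_of_forall_le fun i => ?_
  by_cases hi : i ≤ A.natDegree + B.natDegree
  · rw [coeff_mul]
    refine (Int.natAbs_sum_le _ _).trans ?_
    calc ∑ x ∈ Finset.HasAntidiagonal.antidiagonal i, (A.coeff x.1 * B.coeff x.2).natAbs
        ≤ ∑ _x ∈ Finset.HasAntidiagonal.antidiagonal i, height A * height B :=
          Finset.sum_le_sum fun x _ => by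
            rw [Int.natAbs_mul]
            exact Nat.mul_le_mul (natAbs_coeff_le_height A _) (natAbs_coeff_le_height B _)
      _ = (i + 1) * (height A * height B) := by
          rw [Finset.sum_const, Finset.Nat.card_antidiagonal, smul_eq_mul]
      _ ≤ (A.natDegree + B.natDegree + 1) * (height A * height B) :=
          Nat.mul_le_mul_right _ (by omega)
      _ = (A.natDegree + B.natDegree + 1) * height A * height B := by ring
  · have h0 : (A * B).coeff i = 0 :=
      coeff_eq_zero_of_natDegree_lt (lt_of_le_of_lt natDegree_mul_le (not_le.1 hi))
    rw [h0]; simp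

/-! ### The Chinese remainder combination over `ℚ[X]`, with integer coefficients -/

section CRT

variable {J : Type*} (m : J → ℤ[X])

/-- Hypotheses on the family `m`: monic, irreducible, pairwise distinct integer polynomials. [folklore] -/
structure IsGoodFamily : Prop where
  monic : ∀ j, (m j).Monic
  irreducible : ∀ j, Irreducible (m j)
  injective : Function.Injective m

variable {m}

namespace IsGoodFamily

variable (hm : IsGoodFamily m)
include hm

/-- The `m_j` are irreducible over `ℚ` (Gauss). [folklore] -/
theorem irreducible_map (j : J) : Irreducible ((m j).map (algebraMap ℤ ℚ)) :=
  ((hm.monic j).irreducible_iff_irreducible_map_fraction_map (K := ℚ)).1 (hm.irreducible j)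

/-- The `m_j` have positive degree. [folklore] -/
theorem natDegree_pos (j : J) : 0 < (m j).natDegree := by
  by_contra h
  have h0 : (m j).natDegree = 0 := by omega
  have h1 : m j = 1 := (hm.monic j).natDegree_eq_zero.1 h0
  exact (hm.irreducible j).not_isUnit (h1 ▸ isUnit_one)

/-- Distinct members of the family are coprime over `ℚ`. [folklore] -/
theorem isCoprime_map {i j : J} (hij : i ≠ j) :
    IsCoprime ((m i).map (algebraMap ℤ ℚ)) ((m j).map (algebraMap ℤ ℚ)) := by
  rw [(hm.irreducible_map i).coprime_iff_not_dvd]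
  intro hdvd
  have hassoc : Associated ((m i).map (algebraMap ℤ ℚ)) ((m j).map (algebraMap ℤ ℚ)) := by
    rcases (hm.irreducible_map j).dvd_iff.1 hdvd with hu | ha
    · exact absurd hu (hm.irreducible_map i).not_isUnit
    · exact ha.symm
  have heq := eq_of_monic_of_associated ((hm.monic i).map _) ((hm.monic j).map _) hassoc
  exact hij (hm.injective (Polynomial.map_injective _ (algebraMap ℤ ℚ).injective_int heq))

/-- Distinct members of the family have no common root in any field of characteristic `0`. [folklore] -/
theorem eq_of_aeval_eq_zero {K : Type*} [Field K] [CharZero K] {i j : J} {x : K}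
    (hi : aeval x (m i) = 0) (hj : aeval x (m j) = 0) : i = j := by
  by_contra hij
  obtain ⟨a, b, hab⟩ := hm.isCoprime_map hij
  have h := congrArg (aeval x) hab
  rw [map_add, map_mul, map_mul, aeval_map_algebraMap, aeval_map_algebraMap, hi, hj, mul_zero, mul_zero,
    add_zero, map_one] at h
  exact zero_ne_one h

/-- **CRT data.** Nonzero integers `ρ_j` and integer polynomials `B_j` with `B_j ≡ ρ_j mod m_j` and
`B_j ≡ 0 mod m_i` (`i ≠ j`) in `ℚ[X]` (Bézout for the coprime `m_j`, `∏_{i ≠ j} m_i`, denominators cleared).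
[folklore] -/
theorem exists_crt [Fintype J] :
    ∃ (ρ : J → ℤ) (B : J → ℤ[X]), (∀ j, ρ j ≠ 0) ∧
      (∀ j, ∃ s : ℚ[X], (B j).map (algebraMap ℤ ℚ) = C (ρ j : ℚ) + s * (m j).map (algebraMap ℤ ℚ)) ∧
      (∀ i j, i ≠ j → (m i).map (algebraMap ℤ ℚ) ∣ (B j).map (algebraMap ℤ ℚ)) := by
  classical
  have key : ∀ j, ∃ (ρ : ℤ) (B : ℤ[X]), ρ ≠ 0 ∧
      (∃ s : ℚ[X], B.map (algebraMap ℤ ℚ) = C (ρ : ℚ) + s * (m j).map (algebraMap ℤ ℚ)) ∧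
      (∀ i, i ≠ j → (m i).map (algebraMap ℤ ℚ) ∣ B.map (algebraMap ℤ ℚ)) := by
    intro j
    set Mj : ℚ[X] := ∏ i ∈ Finset.univ.erase j, (m i).map (algebraMap ℤ ℚ) with hMj
    have hcop : IsCoprime ((m j).map (algebraMap ℤ ℚ)) Mj :=
      IsCoprime.prod_right fun i hi => hm.isCoprime_map (Finset.ne_of_mem_erase hi).symm
    obtain ⟨a, b, hab⟩ := hcop
    -- `e := b * Mj ≡ 1 mod m_j`, `≡ 0 mod m_i`
    set e : ℚ[X] := b * Mj with he
    obtain ⟨ρ, hρM, hρ⟩ := IsLocalization.integerNormalization_spec (nonZeroDivisors ℤ) e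
    refine ⟨ρ, IsLocalization.integerNormalization (nonZeroDivisors ℤ) e, nonZeroDivisors.ne_zero hρM, ?_, ?_⟩
    · refine ⟨-(ρ : ℚ[X]) * a, ?_⟩
      rw [hρ, he, zsmul_eq_mul]
      have : b * Mj = 1 - a * (m j).map (algebraMap ℤ ℚ) := by rw [← hab]; ring
      rw [this, Int.cast_comm]
      simp only [← C_eq_intCast]
      ring
    · intro i hij
      rw [hρ, zsmul_eq_mul, he]
      exact Dvd.dvd.mul_left (Dvd.dvd.mul_left (Finset.dvd_prod_of_mem _ (Finset.mem_erase.2 ⟨hij, Finset.mem_univ _⟩)) _) _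
  choose ρ B hρ hB1 hB2 using key
  exact ⟨ρ, B, hρ, hB1, fun i j hij => hB2 j i hij⟩

/-- **The CRT combination.** There are a degree budget `r₀`, a height constant `Cm` and nonzero integers
`ρ_j` (depending only on the family `m`) such that every family of integer polynomials `F_j` with
`deg F_j < deg m_j` glues to an `F ∈ ℤ[X]` with `deg F < r₀`, `H(F) ≤ Cm · max H(F_j)`,
`F(θ) = ρ_j F_j(θ)` at every root `θ` of `m_j` (in any field of characteristic `0`), and `m_j ∤ F`
whenever `m_j ∤ F_j`. [folklore] -/
theorem exists_glue [Fintype J] :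
    ∃ (r₀ Cm : ℕ) (ρ : J → ℤ), (∀ j, ρ j ≠ 0) ∧ ∀ Fj : J → ℤ[X], (∀ j, (Fj j).natDegree < (m j).natDegree) →
      ∃ F : ℤ[X], F.natDegree < r₀ ∧ height F ≤ Cm * Finset.univ.sup (fun j => height (Fj j)) ∧
        (∀ j, ¬ m j ∣ Fj j → ¬ m j ∣ F) ∧
        ∀ (j : J) (K : Type) [Field K] [CharZero K] (θ : K), aeval θ (m j) = 0 →
          aeval θ F = (ρ j : K) * aeval θ (Fj j) := by
  classical
  obtain ⟨ρ, B, hρ, hB1, hB2⟩ := hm.exists_crt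
  set dB : ℕ := Finset.univ.sup fun j => (B j).natDegree
  set dm : ℕ := Finset.univ.sup fun j => (m j).natDegree
  set hB : ℕ := Finset.univ.sup fun j => height (B j)
  refine ⟨dB + dm + 1, Fintype.card J * ((dB + dm + 1) * hB), ρ, hρ, fun Fj hFj => ?_⟩
  set F : ℤ[X] := ∑ j, B j * Fj j with hF
  refine ⟨F, ?_, ?_, ?_, ?_⟩
  · -- degree
    have hle : F.natDegree ≤ dB + dm := by
      refine natDegree_sum_le_of_forall_le _ _ fun j _ => ?_
      refine natDegree_mul_le.trans (add_le_add ?_ ?_)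
      · exact Finset.le_sup (f := fun j => (B j).natDegree) (Finset.mem_univ j)
      · exact (hFj j).le.trans (Finset.le_sup (f := fun j => (m j).natDegree) (Finset.mem_univ j))
    omega
  · -- height
    calc height F ≤ ∑ j, height (B j * Fj j) := height_sum_le _ _
      _ ≤ ∑ _j : J, (dB + dm + 1) * hB * Finset.univ.sup (fun j => height (Fj j)) :=
          Finset.sum_le_sum fun j _ => by
            refine (height_mul_le _ _).trans ?_
            have h1 : (B j).natDegree + (Fj j).natDegree + 1 ≤ dB + dm + 1 := by
              have h1 : (B j).natDegree ≤ dB := Finset.le_sup (f := fun j => (B j).natDegree) (Finset.mem_univ j)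
              have h2 : (Fj j).natDegree ≤ dm :=
                (hFj j).le.trans (Finset.le_sup (f := fun j => (m j).natDegree) (Finset.mem_univ j))
              omega
            have h2 : height (B j) ≤ hB := Finset.le_sup (f := fun j => height (B j)) (Finset.mem_univ j)
            have h3 : height (Fj j) ≤ Finset.univ.sup (fun j => height (Fj j)) :=
              Finset.le_sup (f := fun j => height (Fj j)) (Finset.mem_univ j)
            exact Nat.mul_le_mul (Nat.mul_le_mul h1 h2) h3
      _ = Fintype.card J * ((dB + dm + 1) * hB) * Finset.univ.sup (fun j => height (Fj j)) := by
          rw [Finset.sum_const, Finset.card_univ, smul_eq_mul]; ring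
  · -- non-divisibility
    intro j hj hdvd
    apply hj
    have hQ : (m j).map (algebraMap ℤ ℚ) ∣ F.map (algebraMap ℤ ℚ) := Polynomial.map_dvd _ hdvd
    rw [hF, Polynomial.map_sum] at hQ
    -- all terms with `i ≠ j` are divisible by `m j`
    have hrest : (m j).map (algebraMap ℤ ℚ) ∣
        ∑ i ∈ Finset.univ.erase j, (B i * Fj i).map (algebraMap ℤ ℚ) :=
      Finset.dvd_sum fun i hi => by
        rw [Polynomial.map_mul]
        exact Dvd.dvd.mul_right (hB2 j i (Finset.ne_of_mem_erase hi).symm) _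
    rw [← Finset.add_sum_erase _ _ (Finset.mem_univ j)] at hQ
    have hjterm : (m j).map (algebraMap ℤ ℚ) ∣ (B j * Fj j).map (algebraMap ℤ ℚ) :=
      (dvd_add_left hrest).1 hQ
    obtain ⟨s, hs⟩ := hB1 j
    rw [Polynomial.map_mul, hs, add_mul, mul_assoc] at hjterm
    have h2 : (m j).map (algebraMap ℤ ℚ) ∣ C (ρ j : ℚ) * (Fj j).map (algebraMap ℤ ℚ) :=
      (dvd_add_left (dvd_mul_of_dvd_right (dvd_mul_right _ _) s)).1 hjterm
    have hunit : IsUnit (C (ρ j : ℚ)) := isUnit_C.2 (IsUnit.mk0 _ (Int.cast_ne_zero.2 (hρ j)))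
    have h3 : (m j).map (algebraMap ℤ ℚ) ∣ (Fj j).map (algebraMap ℤ ℚ) := (hunit.dvd_mul_left).1 h2
    exact (map_dvd_map _ (algebraMap ℤ ℚ).injective_int (hm.monic j)).1 h3
  · -- evaluation at a root of `m j`
    intro j K _ _ θ hθ
    rw [hF, map_sum, ← Finset.add_sum_erase _ _ (Finset.mem_univ j)]
    have hzero : ∑ i ∈ Finset.univ.erase j, aeval θ (B i * Fj i) = 0 := by
      refine Finset.sum_eq_zero fun i hi => ?_
      obtain ⟨c, hc⟩ := hB2 j i (Finset.ne_of_mem_erase hi).symm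
      have hBi : aeval θ (B i) = 0 := by
        rw [← aeval_map_algebraMap ℚ, hc, map_mul, aeval_map_algebraMap, hθ, zero_mul]
      rw [map_mul, hBi, zero_mul]
    obtain ⟨s, hs⟩ := hB1 j
    have hBj : aeval θ (B j) = (ρ j : K) := by
      rw [← aeval_map_algebraMap ℚ, hs, map_add, map_mul, aeval_map_algebraMap, hθ, mul_zero, add_zero, aeval_C,
        map_intCast]
    rw [hzero, add_zero, map_mul, hBj]

end IsGoodFamily

end CRT


/-! ### Roots of the family in `\overline{ℚ_p}` and their minimal polynomials over `ℤ_p` -/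

/-- `ℤ_p → \overline{ℚ_p}` is injective. [folklore] -/
theorem faithfulSMul_padicInt_padicAlgCl : FaithfulSMul ℤ_[p] (PadicAlgCl p) := by
  rw [faithfulSMul_iff_algebraMap_injective, IsScalarTower.algebraMap_eq ℤ_[p] ℚ_[p] (PadicAlgCl p)]
  exact (algebraMap ℚ_[p] (PadicAlgCl p)).injective.comp (IsFractionRing.injective ℤ_[p] ℚ_[p])

section Roots

variable (p) {J : Type*} (m : J → ℤ[X])

/-- The roots of `m j` in `\overline{ℚ_p}`. [folklore] -/
def rts (j : J) : Multiset (PadicAlgCl p) := ((m j).map (algebraMap ℤ (PadicAlgCl p))).roots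

variable {p m}

namespace IsGoodFamily

variable (hm : IsGoodFamily m)
include hm

/-- `m_j ≠ 0` in `\overline{ℚ_p}[X]`. [folklore] -/
theorem map_padicAlgCl_ne_zero (j : J) : (m j).map (algebraMap ℤ (PadicAlgCl p)) ≠ 0 :=
  ((hm.monic j).map _).ne_zero

/-- Membership in `rts`: `θ` is a root of `m_j`. [folklore] -/
theorem mem_rts_iff {j : J} {θ : PadicAlgCl p} : θ ∈ rts p m j ↔ aeval θ (m j) = 0 := by
  rw [rts, mem_roots (hm.map_padicAlgCl_ne_zero j), IsRoot.def, eval_map_algebraMap]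

omit hm in
/-- `m_j` over `\overline{ℚ_p}`, through `ℚ`. [folklore] -/
theorem map_padicAlgCl_eq_map_map (j : J) :
    (m j).map (algebraMap ℤ (PadicAlgCl p)) = ((m j).map (algebraMap ℤ ℚ)).map (algebraMap ℚ (PadicAlgCl p)) := by
  rw [Polynomial.map_map, ← IsScalarTower.algebraMap_eq ℤ ℚ (PadicAlgCl p)]

/-- The roots of `m_j` in `\overline{ℚ_p}` are distinct (separability in characteristic `0`). [folklore] -/
theorem nodup_rts (j : J) : (rts p m j).Nodup := by
  rw [rts, map_padicAlgCl_eq_map_map (p := p) (m := m) j]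
  exact nodup_roots (hm.irreducible_map j).separable.map

/-- `m_j` has `deg m_j` roots in `\overline{ℚ_p}`. [folklore] -/
theorem card_rts (j : J) : Multiset.card (rts p m j) = (m j).natDegree := by
  rw [rts, ← (IsAlgClosed.splits _).natDegree_eq_card_roots, (hm.monic j).natDegree_map]

/-- `m_j` has a root in `\overline{ℚ_p}`. [folklore] -/
theorem rts_toFinset_nonempty (j : J) : (rts p m j).toFinset.Nonempty := by
  rw [Multiset.toFinset_nonempty, Ne, ← Multiset.card_eq_zero, hm.card_rts]
  exact (hm.natDegree_pos j).ne'

/-- Roots of `m_j` are integral over `ℤ`. [folklore] -/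
theorem isIntegral_int_of_mem_rts {j : J} {θ : PadicAlgCl p} (h : θ ∈ rts p m j) : IsIntegral ℤ θ :=
  ⟨m j, hm.monic j, by rw [← aeval_def]; exact hm.mem_rts_iff.1 h⟩

/-- Roots of `m_j` are integral over `ℤ_p`. [folklore] -/
theorem isIntegral_of_mem_rts {j : J} {θ : PadicAlgCl p} (h : θ ∈ rts p m j) : IsIntegral ℤ_[p] θ :=
  (hm.isIntegral_int_of_mem_rts h).tower_top

/-- Roots of `m_j` have norm `≤ 1`. [folklore] -/
theorem norm_le_one_of_mem_rts {j : J} {θ : PadicAlgCl p} (h : θ ∈ rts p m j) : ‖θ‖ ≤ 1 := by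
  refine PadicInt.norm_le_one_of_eval_map_eq_zero ((hm.monic j).map (Int.castRingHom ℤ_[p])) ?_
  rw [← aeval_eq_eval_map_map]
  exact hm.mem_rts_iff.1 h
set_option maxHeartbeats 400000 in -- buildfix (bf3-g26): 160k/180k FAIL, 200k PASS at accept time; line-neutral budget line
/-- Distinct `m_i`, `m_j` have no common root in `\overline{ℚ_p}`. [folklore] -/
theorem eq_of_mem_rts {i j : J} {θ : PadicAlgCl p} (hi : θ ∈ rts p m i) (hj : θ ∈ rts p m j) : i = j :=
  hm.eq_of_aeval_eq_zero (hm.mem_rts_iff.1 hi) (hm.mem_rts_iff.1 hj)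

/-- A nonzero integer polynomial of degree `< deg m_j` does not vanish at a root of `m_j` (whose minimal
polynomial over `ℚ` is `m_j`). [folklore] -/
theorem aeval_ne_zero_of_natDegree_lt {j : J} {θ : PadicAlgCl p} (hθ : θ ∈ rts p m j) {G : ℤ[X]}
    (hG0 : G ≠ 0) (hG : G.natDegree < (m j).natDegree) : aeval θ G ≠ 0 := by
  intro h0
  have hmin : (m j).map (algebraMap ℤ ℚ) = minpoly ℚ θ :=
    minpoly.eq_of_irreducible_of_monic (hm.irreducible_map j)
      (by rw [aeval_map_algebraMap]; exact hm.mem_rts_iff.1 hθ) ((hm.monic j).map _)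
  have h0' : aeval θ (G.map (algebraMap ℤ ℚ)) = 0 := by rwa [aeval_map_algebraMap]
  have hG0' : G.map (algebraMap ℤ ℚ) ≠ 0 := (Polynomial.map_ne_zero_iff (algebraMap ℤ ℚ).injective_int).2 hG0
  have hdeg := minpoly.degree_le_of_ne_zero ℚ θ hG0' h0'
  rw [← hmin, (hm.monic j).degree_map, degree_map_eq_of_injective (algebraMap ℤ ℚ).injective_int] at hdeg
  exact absurd (natDegree_le_natDegree hdeg) (not_le.2 hG)

/-- The minimal polynomial over `ℤ_p` of a root of `m_j` divides `m_j`. [folklore] -/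
theorem minpoly_dvd {j : J} {θ : PadicAlgCl p} (hθ : θ ∈ rts p m j) :
    minpoly ℤ_[p] θ ∣ (m j).map (algebraMap ℤ ℤ_[p]) := by
  haveI := faithfulSMul_padicInt_padicAlgCl (p := p)
  exact minpoly.isIntegrallyClosed_dvd (hm.isIntegral_of_mem_rts hθ)
    (by rw [aeval_map_algebraMap]; exact hm.mem_rts_iff.1 hθ)

/-- The minimal polynomial over `ℤ_p` of a root of `m_j` has degree `≤ deg m_j`. [folklore] -/
theorem natDegree_minpoly_le {j : J} {θ : PadicAlgCl p} (hθ : θ ∈ rts p m j) :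
    (minpoly ℤ_[p] θ).natDegree ≤ (m j).natDegree := by
  have h := natDegree_le_of_dvd (hm.minpoly_dvd hθ) ((hm.monic j).map _).ne_zero
  rwa [(hm.monic j).natDegree_map] at h

/-- The minimal polynomial over `ℤ_p` of a root of `m_j` has positive degree. [folklore] -/
theorem natDegree_minpoly_pos {j : J} {θ : PadicAlgCl p} (hθ : θ ∈ rts p m j) :
    0 < (minpoly ℤ_[p] θ).natDegree :=
  minpoly.natDegree_pos (hm.isIntegral_of_mem_rts hθ)

/-- The roots in `\overline{ℚ_p}` of the minimal polynomial of `θ` over `ℤ_p` (the `ℚ_p`-conjugates of `θ`):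
`deg` many, distinct, all roots of the same `m_j`, all of the same multiplicity in any `Q ∈ ℤ_p[X]`.
[folklore] -/
theorem minpoly_roots {j : J} {θ : PadicAlgCl p} (hθ : θ ∈ rts p m j) :
    ((minpoly ℤ_[p] θ).map (algebraMap ℤ_[p] (PadicAlgCl p))).roots.Nodup ∧
    Multiset.card ((minpoly ℤ_[p] θ).map (algebraMap ℤ_[p] (PadicAlgCl p))).roots =
      (minpoly ℤ_[p] θ).natDegree ∧
    (∀ θ' ∈ ((minpoly ℤ_[p] θ).map (algebraMap ℤ_[p] (PadicAlgCl p))).roots, θ' ∈ rts p m j) ∧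
    (∀ θ' ∈ ((minpoly ℤ_[p] θ).map (algebraMap ℤ_[p] (PadicAlgCl p))).roots,
      aeval θ' (minpoly ℤ_[p] θ) = 0) ∧
    ∀ (Q : ℤ_[p][X]), ∀ θ' ∈ ((minpoly ℤ_[p] θ).map (algebraMap ℤ_[p] (PadicAlgCl p))).roots,
      rootMultiplicity θ' (Q.map (algebraMap ℤ_[p] (PadicAlgCl p))) =
        rootMultiplicity θ (Q.map (algebraMap ℤ_[p] (PadicAlgCl p))) := by
  have hint := hm.isIntegral_of_mem_rts hθ
  set G := minpoly ℤ_[p] θ with hG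
  set Gm := G.map (algebraMap ℤ_[p] (PadicAlgCl p)) with hGm
  have hGmonic : G.Monic := minpoly.monic hint
  have hGm0 : Gm ≠ 0 := (hGmonic.map _).ne_zero
  have haQ : IsIntegral ℚ_[p] θ := Algebra.IsIntegral.isIntegral θ
  have hGmQ : Gm = (minpoly ℚ_[p] θ).map (algebraMap ℚ_[p] (PadicAlgCl p)) := by
    rw [hGm, hG, minpoly.isIntegrallyClosed_eq_field_fractions' ℚ_[p] hint, Polynomial.map_map,
      ← IsScalarTower.algebraMap_eq ℤ_[p] ℚ_[p] (PadicAlgCl p)]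
  have hsep : Gm.Separable := by rw [hGmQ]; exact (minpoly.irreducible haQ).separable.map
  have hmem : ∀ θ' ∈ Gm.roots, aeval θ' G = 0 := fun θ' h => by
    have h1 := (mem_roots hGm0).1 h
    rwa [IsRoot.def, hGm, eval_map_algebraMap] at h1
  refine ⟨nodup_roots hsep, ?_, ?_, hmem, ?_⟩
  · rw [← (IsAlgClosed.splits Gm).natDegree_eq_card_roots, hGm, hGmonic.natDegree_map]
  · intro θ' h
    have hdvd : Gm ∣ (m j).map (algebraMap ℤ (PadicAlgCl p)) := by
      rw [IsScalarTower.algebraMap_eq ℤ ℤ_[p] (PadicAlgCl p), ← Polynomial.map_map]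
      exact Polynomial.map_dvd _ (hm.minpoly_dvd hθ)
    exact Multiset.mem_of_le (roots.le_of_dvd (hm.map_padicAlgCl_ne_zero j) hdvd) h
  · intro Q θ' h
    exact PadicInt.rootMultiplicity_eq_of_aeval_minpoly_eq_zero Q hint (hmem θ' h)

/-- `θ` is a root of its minimal polynomial over `ℤ_p`. [folklore] -/
theorem mem_minpoly_roots_self {j : J} {θ : PadicAlgCl p} (hθ : θ ∈ rts p m j) :
    θ ∈ ((minpoly ℤ_[p] θ).map (algebraMap ℤ_[p] (PadicAlgCl p))).roots := by
  have hint := hm.isIntegral_of_mem_rts hθ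
  rw [mem_roots (((minpoly.monic hint)).map _).ne_zero, IsRoot.def, eval_map_algebraMap]
  exact minpoly.aeval ℤ_[p] θ

end IsGoodFamily

end Roots


/-! ### One prime: the multiplicities are constant on each `m_j` -/

section OnePrime

variable {J : Type*} [Fintype J] {m : J → ℤ[X]}

namespace IsGoodFamily

variable (hm : IsGoodFamily m)
include hm

/-- A monic `Q ∈ ℤ_p[X]` whose roots in `\overline{ℚ_p}` are `∑_j n_j • roots(m_j)` is `∏_j m_j^{n_j}`.
[folklore] -/
theorem eq_prod_pow_of_roots_eq {Q : ℤ_[p][X]} (hQ : Q.Monic) (n : J → ℕ)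
    (heq : (Q.map (algebraMap ℤ_[p] (PadicAlgCl p))).roots = ∑ j, n j • rts p m j) :
    Q = ∏ j, ((m j).map (algebraMap ℤ ℤ_[p])) ^ n j := by
  classical
  have hinj : Function.Injective (algebraMap ℤ_[p] (PadicAlgCl p)) :=
    (faithfulSMul_iff_algebraMap_injective _ _).1 faithfulSMul_padicInt_padicAlgCl
  apply Polynomial.map_injective _ hinj
  have hmA : ∀ j, ((m j).map (algebraMap ℤ ℤ_[p])).map (algebraMap ℤ_[p] (PadicAlgCl p)) =
      (m j).map (algebraMap ℤ (PadicAlgCl p)) := fun j => by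
    rw [Polynomial.map_map, ← IsScalarTower.algebraMap_eq ℤ ℤ_[p] (PadicAlgCl p)]
  rw [Polynomial.map_prod]
  simp only [Polynomial.map_pow, hmA]
  rw [(IsAlgClosed.splits _).eq_prod_roots_of_monic (hQ.map (algebraMap ℤ_[p] (PadicAlgCl p))), heq]
  have hmapsum : Multiset.map (fun b : PadicAlgCl p => X - C b) (∑ j, n j • rts p m j) =
      ∑ j, Multiset.map (fun b : PadicAlgCl p => X - C b) (n j • rts p m j) :=
    map_sum (Multiset.mapAddMonoidHom fun b : PadicAlgCl p => X - C b) _ _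
  rw [hmapsum, Multiset.prod_sum]
  simp only [Multiset.map_nsmul, Multiset.prod_nsmul]
  refine Finset.prod_congr rfl fun j _ => ?_
  congr 1
  exact ((IsAlgClosed.splits _).eq_prod_roots_of_monic ((hm.monic j).map (algebraMap ℤ (PadicAlgCl p)))).symm

/-- **Upper count.** If all roots of the monic `Q ∈ ℤ_p[X]` are roots of the family, then
`roots(Q) ≤ ∑_j μ_j • roots(m_j)` with `μ_j` the maximal multiplicity in `Q` of a root of `m_j`; in
particular `deg Q ≤ ∑_j μ_j deg m_j`. [folklore] -/
theorem roots_le_sum_sup_nsmul {Q : ℤ_[p][X]}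
    (hroots : ∀ b ∈ (Q.map (algebraMap ℤ_[p] (PadicAlgCl p))).roots, ∃ j, b ∈ rts p m j) :
    (Q.map (algebraMap ℤ_[p] (PadicAlgCl p))).roots ≤
      ∑ j, ((rts p m j).toFinset.sup fun θ => rootMultiplicity θ (Q.map (algebraMap ℤ_[p] (PadicAlgCl p)))) •
        rts p m j := by
  classical
  set QA := Q.map (algebraMap ℤ_[p] (PadicAlgCl p)) with hQA
  rw [Multiset.le_iff_count]
  intro b
  by_cases hb : b ∈ QA.roots
  · obtain ⟨j, hj⟩ := hroots b hb
    rw [Multiset.count_sum']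
    refine le_trans ?_ (Finset.single_le_sum (f := fun i => Multiset.count b ((((rts p m i).toFinset.sup
      fun θ => rootMultiplicity θ QA)) • rts p m i)) (fun i _ => Nat.zero_le _) (Finset.mem_univ j))
    simp only [Multiset.count_nsmul]
    rw [Multiset.count_eq_one_of_mem (hm.nodup_rts j) hj, mul_one, count_roots]
    exact Finset.le_sup (f := fun θ => rootMultiplicity θ QA) (Multiset.mem_toFinset.2 hj)
  · rw [Multiset.count_eq_zero_of_notMem hb]
    exact Nat.zero_le _

/-- `deg Q ≤ ∑_j μ_j deg m_j` (`μ_j` the maximal multiplicity in `Q` of a root of `m_j`). [folklore] -/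
theorem natDegree_le_sum_sup {Q : ℤ_[p][X]} (hQ : Q.Monic)
    (hroots : ∀ b ∈ (Q.map (algebraMap ℤ_[p] (PadicAlgCl p))).roots, ∃ j, b ∈ rts p m j) :
    Q.natDegree ≤
      ∑ j, ((rts p m j).toFinset.sup fun θ => rootMultiplicity θ (Q.map (algebraMap ℤ_[p] (PadicAlgCl p)))) *
        (m j).natDegree := by
  have h := Multiset.card_le_card (hm.roots_le_sum_sup_nsmul (p := p) hroots)
  rw [← (IsAlgClosed.splits _).natDegree_eq_card_roots, hQ.natDegree_map, Multiset.card_sum] at h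
  simp only [Multiset.card_nsmul] at h
  refine h.trans (le_of_eq (Finset.sum_congr rfl fun j _ => ?_))
  rw [hm.card_rts]

/-- **The pigeonhole inequality (heart of the rigidity theorem).** Let `Q ∈ ℤ_p[X]` be monic with all
roots among the roots of the family, and assume the KERNEL BOUND: for every degree budget `r` there is
`C` with `kerNorm Q F ≤ C · H(F)^{deg Q}` for all integer `F` of degree `< r` coprime to every `m_j`.
Then `∑_j μ_j deg m_j ≤ deg Q`, `μ_j` the maximal multiplicity in `Q` of a root of `m_j`.
Proof: serve every `j` by a small integer polynomial, `p`-adically deep on the `ℚ_p`-conjugates of a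
root of maximal multiplicity (`exists_small_deep`), glue by the CRT (`exists_glue`), and compare
`p^{u ∑ μ_j d_j} ≤ kerNorm Q F ≤ C' p^{u deg Q}` for `u → ∞`. [folklore] -/
theorem sum_sup_mul_natDegree_le {Q : ℤ_[p][X]} (hQ : Q.Monic)
    (hroots : ∀ b ∈ (Q.map (algebraMap ℤ_[p] (PadicAlgCl p))).roots, ∃ j, b ∈ rts p m j)
    (hbound : ∀ r : ℕ, ∃ C : ℝ, ∀ F : ℤ[X], F.natDegree < r → (∀ j, ¬ m j ∣ F) →
      kerNorm Q F ≤ C * (height F : ℝ) ^ Q.natDegree) :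
    ∑ j, ((rts p m j).toFinset.sup fun θ => rootMultiplicity θ (Q.map (algebraMap ℤ_[p] (PadicAlgCl p)))) *
        (m j).natDegree ≤ Q.natDegree := by
  classical
  have hp : p.Prime := Fact.out
  set QA := Q.map (algebraMap ℤ_[p] (PadicAlgCl p)) with hQA
  set N := Q.natDegree with hN
  set μ : J → ℕ := fun j => (rts p m j).toFinset.sup fun θ => rootMultiplicity θ QA with hμ
  set d : J → ℕ := fun j => (m j).natDegree with hd
  -- maximizers
  have hmax : ∀ j, ∃ θ ∈ (rts p m j).toFinset, μ j = rootMultiplicity θ QA := fun j =>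
    Finset.exists_mem_eq_sup _ (hm.rts_toFinset_nonempty j) _
  choose θ hθmem hθmax using hmax
  have hθ : ∀ j, θ j ∈ rts p m j := fun j => Multiset.mem_toFinset.1 (hθmem j)
  -- minimal polynomials and their degrees
  set g : J → ℤ_[p][X] := fun j => minpoly ℤ_[p] (θ j) with hg
  set e : J → ℕ := fun j => (g j).natDegree with he
  have hgmonic : ∀ j, (g j).Monic := fun j => minpoly.monic (hm.isIntegral_of_mem_rts (hθ j))
  have he0 : ∀ j, 0 < e j := fun j => hm.natDegree_minpoly_pos (hθ j)
  have hed : ∀ j, e j ≤ d j := fun j => hm.natDegree_minpoly_le (hθ j)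
  have hd0 : ∀ j, 0 < d j := fun j => hm.natDegree_pos j
  set E : ℕ := ∏ j, e j with hE
  have hE0 : 0 < E := Finset.prod_pos fun j _ => he0 j
  -- the gluing data and the bound
  obtain ⟨r₀, Cm, ρ, hρ, hglue⟩ := hm.exists_glue
  obtain ⟨Cb, hCb⟩ := hbound r₀
  -- reduce to an inequality of powers of `p`
  have hp1 : (1 : ℝ) < p := by exact_mod_cast hp.one_lt
  suffices key : ∀ k : ℕ, 0 < k →
      (p : ℝ) ^ (k * (E * ∑ j, μ j * d j)) ≤ (max Cb 0 * (Cm : ℝ) ^ N) * (p : ℝ) ^ (k * (E * N)) by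
    exact Nat.le_of_mul_le_mul_left (nat_le_of_forall_pow_le hp1 key) hE0
  intro k hk
  set u : ℕ := k * E with hu
  -- depths
  have hdvd : ∀ j, e j ∣ u * d j := fun j =>
    Dvd.dvd.mul_right (Dvd.dvd.mul_left (Finset.dvd_prod_of_mem e (Finset.mem_univ j)) k) _
  set t : J → ℕ := fun j => u * d j / e j with ht
  have hte : ∀ j, t j * e j = u * d j := fun j => Nat.div_mul_cancel (hdvd j)
  -- the local test polynomials
  have hloc : ∀ j, ∃ F : ℤ[X], F ≠ 0 ∧ F.natDegree < d j ∧ height F ≤ p ^ u ∧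
      ∃ H : ℤ_[p][X], F.map (Int.castRingHom ℤ_[p]) %ₘ g j = C ((p : ℤ_[p]) ^ t j) * H := fun j =>
    exists_small_deep (hgmonic j) (he0 j) (hd0 j) (le_of_eq (hte j))
  choose Fj hFj0 hFjdeg hFjht Hj hHj using hloc
  have hFjnd : ∀ j, ¬ m j ∣ Fj j := fun j h =>
    absurd (natDegree_le_of_dvd h (hFj0 j)) (not_le.2 (hFjdeg j))
  -- glue
  obtain ⟨F, hFdeg, hFht, hFnd, hFeval⟩ := hglue Fj hFjdeg
  have hFnd' : ∀ j, ¬ m j ∣ F := fun j => hFnd j (hFjnd j)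
  -- `F` does not vanish on the roots of the family
  have hFevalP : ∀ j (b : PadicAlgCl p), aeval b (m j) = 0 → aeval b F = (ρ j : PadicAlgCl p) * aeval b (Fj j) :=
    fun j b hb => hFeval j (PadicAlgCl p) b hb
  have hFne : ∀ j, ∀ b ∈ rts p m j, aeval b F ≠ 0 := by
    intro j b hj
    rw [hFevalP j b (hm.mem_rts_iff.1 hj)]
    exact mul_ne_zero (Int.cast_ne_zero.2 (hρ j)) (hm.aeval_ne_zero_of_natDegree_lt hj (hFj0 j) (hFjdeg j))
  have hFroot : ∀ b ∈ QA.roots, aeval b F ≠ 0 := by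
    intro b hb
    obtain ⟨j, hj⟩ := hroots b hb
    exact hFne j b hj
  -- UPPER BOUND
  have hup : kerNorm Q F ≤ (max Cb 0 * (Cm : ℝ) ^ N) * (p : ℝ) ^ (k * (E * N)) := by
    have h1 := hCb F hFdeg hFnd'
    have hsup : Finset.univ.sup (fun j => height (Fj j)) ≤ p ^ u := Finset.sup_le fun j _ => hFjht j
    have hHF : (height F : ℝ) ≤ (Cm : ℝ) * (p : ℝ) ^ u := by
      have : height F ≤ Cm * p ^ u := hFht.trans (Nat.mul_le_mul_left _ hsup)
      exact_mod_cast this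
    calc kerNorm Q F ≤ Cb * (height F : ℝ) ^ N := h1
      _ ≤ max Cb 0 * (height F : ℝ) ^ N := mul_le_mul_of_nonneg_right (le_max_left _ _) (by positivity)
      _ ≤ max Cb 0 * ((Cm : ℝ) * (p : ℝ) ^ u) ^ N :=
          mul_le_mul_of_nonneg_left (pow_le_pow_left₀ (by positivity) hHF N) (le_max_right _ _)
      _ = (max Cb 0 * (Cm : ℝ) ^ N) * (p : ℝ) ^ (k * (E * N)) := by
          rw [mul_pow, ← pow_mul, hu]; ring
  -- LOWER BOUND
  obtain hmr := fun j => hm.minpoly_roots (p := p) (hθ j)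
  set S : J → Multiset (PadicAlgCl p) := fun j => ((g j).map (algebraMap ℤ_[p] (PadicAlgCl p))).roots with hS
  have hT : ∑ j, μ j • S j ≤ QA.roots := by
    refine sum_nsmul_le (fun j => (hmr j).1) (fun i j b hi hj => ?_) (fun j b hb => ?_)
    · exact hm.eq_of_mem_rts ((hmr i).2.2.1 b hi) ((hmr j).2.2.1 b hj)
    · rw [count_roots, (hmr j).2.2.2.2 Q b hb, ← hθmax j]
  have hterm : ∀ j, ((p : ℝ) ^ (t j)) ^ (e j) ≤ ((S j).map fun b => ‖aeval b F‖⁻¹).prod := by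
    intro j
    have hcard : Multiset.card (S j) = e j := (hmr j).2.1
    rw [← hcard]
    refine pow_card_le_prod_map (S j) (by positivity) fun b hb => ?_
    have hbF : aeval b F = (ρ j : PadicAlgCl p) * aeval b (Fj j) :=
      hFevalP j b (hm.mem_rts_iff.1 ((hmr j).2.2.1 b hb))
    have hle : ‖aeval b F‖ ≤ (p : ℝ) ^ (-(t j : ℤ)) := by
      rw [hbF, norm_mul]
      calc ‖(ρ j : PadicAlgCl p)‖ * ‖aeval b (Fj j)‖ ≤ 1 * (p : ℝ) ^ (-(t j : ℤ)) :=
            mul_le_mul (norm_intCast_le_one _) (norm_aeval_le_of_modByMonic_eq (hgmonic j) (hHj j)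
              ((hmr j).2.2.2.1 b hb)) (norm_nonneg _) zero_le_one
        _ = (p : ℝ) ^ (-(t j : ℤ)) := one_mul _
    have hpos : 0 < ‖aeval b F‖ := norm_pos_iff.2 (hFne j b ((hmr j).2.2.1 b hb))
    have h := inv_anti₀ hpos hle
    rwa [zpow_neg, inv_inv, zpow_natCast] at h
  have hexp : ∑ j, t j * e j * μ j = k * (E * ∑ j, μ j * d j) := by
    rw [Finset.mul_sum, Finset.mul_sum]
    refine Finset.sum_congr rfl fun j _ => ?_
    rw [hte j, hu]; ring
  have hlow : (p : ℝ) ^ (k * (E * ∑ j, μ j * d j)) ≤ kerNorm Q F := by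
    refine le_trans ?_ (prod_le_kerNorm hQ hFroot hT)
    have hmapsum : Multiset.map (fun b => ‖aeval b F‖⁻¹) (∑ j, μ j • S j) =
        ∑ j, Multiset.map (fun b => ‖aeval b F‖⁻¹) (μ j • S j) :=
      map_sum (Multiset.mapAddMonoidHom fun b => ‖aeval b F‖⁻¹) _ _
    rw [hmapsum, Multiset.prod_sum]
    simp only [Multiset.map_nsmul, Multiset.prod_nsmul]
    calc (p : ℝ) ^ (k * (E * ∑ j, μ j * d j)) = ∏ j, (((p : ℝ) ^ t j) ^ e j) ^ μ j := by
          rw [← hexp, ← Finset.prod_pow_eq_pow_sum]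
          refine Finset.prod_congr rfl fun j _ => ?_
          rw [← pow_mul, ← pow_mul, mul_assoc]
      _ ≤ ∏ j, ((S j).map fun b => ‖aeval b F‖⁻¹).prod ^ μ j :=
          Finset.prod_le_prod (fun j _ => by positivity) fun j _ => pow_le_pow_left₀ (by positivity) (hterm j) _
  exact hlow.trans hup


/-- **Rigidity at one prime.** Let `m_j ∈ ℤ[X]` be monic, irreducible and pairwise distinct, and let
`Q ∈ ℤ_p[X]` be monic with all its roots (in `\overline{ℚ_p}`) among the roots of the `m_j`. If the
KERNEL BOUND holds — for every degree budget `r` a constant `C` with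
`∏_{Q(b)=0} |F(b)|_p⁻¹ ≤ C · H(F)^{deg Q}` for all `F ∈ ℤ[X]` of degree `< r` divisible by no `m_j` — then
every root of `m_j` has one and the same multiplicity `n_j` in `Q`, i.e. `Q = ∏_j m_j^{n_j}`; in
particular `Q` has integer coefficients. (For `Q` the characteristic polynomial of the Frobenius of an
abelian variety on the `p`-adic Tate module the bound is the theorem of the cube; the conclusion is the
integrality half of Weil's theorem, Mumford §19 Thm. 4 / Milne 1986 Thm. 19.1 (a), obtained here without
the polynomiality of the degree function.) [folklore] -/
theorem eq_prod_pow_of_kerNorm_le {Q : ℤ_[p][X]} (hQ : Q.Monic)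
    (hroots : ∀ b ∈ (Q.map (algebraMap ℤ_[p] (PadicAlgCl p))).roots, ∃ j, b ∈ rts p m j)
    (hbound : ∀ r : ℕ, ∃ C : ℝ, ∀ F : ℤ[X], F.natDegree < r → (∀ j, ¬ m j ∣ F) →
      kerNorm Q F ≤ C * (height F : ℝ) ^ Q.natDegree) :
    ∃ n : J → ℕ, Q = ∏ j, ((m j).map (algebraMap ℤ ℤ_[p])) ^ n j ∧
      (∑ j, n j * (m j).natDegree = Q.natDegree) ∧
      ∀ j, ∀ θ ∈ rts p m j, rootMultiplicity θ (Q.map (algebraMap ℤ_[p] (PadicAlgCl p))) = n j := by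
  classical
  set QA := Q.map (algebraMap ℤ_[p] (PadicAlgCl p)) with hQA
  set μ : J → ℕ := fun j => (rts p m j).toFinset.sup fun θ => rootMultiplicity θ QA with hμ
  have hle : QA.roots ≤ ∑ j, μ j • rts p m j := hm.roots_le_sum_sup_nsmul hroots
  have hsum : ∑ j, μ j * (m j).natDegree = Q.natDegree :=
    le_antisymm (hm.sum_sup_mul_natDegree_le hQ hroots hbound) (hm.natDegree_le_sum_sup hQ hroots)
  have hcardQA : Multiset.card QA.roots = Q.natDegree := by
    rw [← (IsAlgClosed.splits QA).natDegree_eq_card_roots, hQA, hQ.natDegree_map]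
  have hcard : Multiset.card (∑ j, μ j • rts p m j) ≤ Multiset.card QA.roots := by
    rw [hcardQA, ← hsum, Multiset.card_sum]
    simp only [Multiset.card_nsmul]
    refine le_of_eq (Finset.sum_congr rfl fun j _ => ?_)
    rw [hm.card_rts]
  have heq : QA.roots = ∑ j, μ j • rts p m j := Multiset.eq_of_le_of_card_le hle hcard
  refine ⟨μ, hm.eq_prod_pow_of_roots_eq hQ μ heq, hsum, ?_⟩
  -- the common multiplicity
  intro j θ hθ
  rw [← count_roots, heq, Multiset.count_sum', Finset.sum_eq_single j]
  · rw [Multiset.count_nsmul, Multiset.count_eq_one_of_mem (hm.nodup_rts j) hθ, mul_one]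
  · intro i _ hij
    rw [Multiset.count_nsmul, Multiset.count_eq_zero_of_notMem, mul_zero]
    exact fun hi => hij (hm.eq_of_mem_rts hi hθ)
  · intro h; exact absurd (Finset.mem_univ j) h


/-- The model polynomial `∏_j m_j^{n_j}` over `ℤ_p` is monic. [folklore] -/
theorem monic_prod_pow (n : J → ℕ) : (∏ j, ((m j).map (algebraMap ℤ ℤ_[p])) ^ n j).Monic :=
  monic_prod_of_monic _ _ fun j _ => ((hm.monic j).map _).pow _

/-- The roots of `∏_j m_j^{n_j}` in `\overline{ℚ_p}`: `∑_j n_j • roots(m_j)`. [folklore] -/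
theorem roots_prod_pow (n : J → ℕ) :
    ((∏ j, ((m j).map (algebraMap ℤ ℤ_[p])) ^ n j).map (algebraMap ℤ_[p] (PadicAlgCl p))).roots =
      ∑ j, n j • rts p m j := by
  classical
  have hmA : ∀ j, ((m j).map (algebraMap ℤ ℤ_[p])).map (algebraMap ℤ_[p] (PadicAlgCl p)) =
      (m j).map (algebraMap ℤ (PadicAlgCl p)) := fun j => by
    rw [Polynomial.map_map, ← IsScalarTower.algebraMap_eq ℤ ℤ_[p] (PadicAlgCl p)]
  rw [Polynomial.map_prod]
  simp only [Polynomial.map_pow, hmA]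
  have hne : ∏ j, (m j).map (algebraMap ℤ (PadicAlgCl p)) ^ n j ≠ 0 :=
    (monic_prod_of_monic _ _ fun j _ => ((hm.monic j).map _).pow _).ne_zero
  rw [roots_prod _ _ hne]
  simp only [roots_pow]
  rw [Finset.sum_eq_multiset_sum]
  rfl

end IsGoodFamily

end OnePrime

/-! ### Two primes: domination of multiplicities -/

section TwoPrimes

variable {q : ℕ} [Fact q.Prime] {J : Type*} [Fintype J] {m : J → ℤ[X]}

namespace IsGoodFamily

variable (hm : IsGoodFamily m)
include hm

/-- **Rigidity across two primes (domination).** Let the model `∏_j m_j^{n_j}` at the prime `p`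
(`∑ n_j deg m_j = N`) and a monic `Q' ∈ ℤ_q[X]` at the prime `q`, with roots among the roots of the family,
satisfy the JOINT KERNEL BOUND `kerNorm_p(∏ m_j^{n_j}, F) · kerNorm_q(Q', F) ≤ C · H(F)^N` for all integer `F`
of degree `< r` divisible by no `m_j` (every `r`, some `C = C(r)`). Then every root of `m_j` in
`\overline{ℚ_q}` has multiplicity `≤ n_j` in `Q'`. (Hence, if also `deg Q' = N`, `Q' = ∏ m_j^{n_j}`:
`ℓ`-independence; and at `q = char` with `deg Q' < N`: the étale `p`-adic multiplicities are dominated.)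
[folklore] -/
theorem rootMultiplicity_le_of_kerNorm_mul_le (n : J → ℕ) {N : ℕ} (hN : ∑ j, n j * (m j).natDegree = N)
    {Q' : ℤ_[q][X]} (hQ' : Q'.Monic)
    (hroots' : ∀ b ∈ (Q'.map (algebraMap ℤ_[q] (PadicAlgCl q))).roots, ∃ j, b ∈ rts q m j)
    (hbound : ∀ r : ℕ, ∃ C : ℝ, ∀ F : ℤ[X], F.natDegree < r → (∀ j, ¬ m j ∣ F) →
      kerNorm (∏ j, ((m j).map (algebraMap ℤ ℤ_[p])) ^ n j) F * kerNorm Q' F ≤ C * (height F : ℝ) ^ N)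
    (j₀ : J) {θ₀ : PadicAlgCl q} (hθ₀ : θ₀ ∈ rts q m j₀) :
    rootMultiplicity θ₀ (Q'.map (algebraMap ℤ_[q] (PadicAlgCl q))) ≤ n j₀ := by
  classical
  have hp : p.Prime := Fact.out
  have hq : q.Prime := Fact.out
  set P : ℤ_[p][X] := ∏ j, ((m j).map (algebraMap ℤ ℤ_[p])) ^ n j with hP
  set PA := P.map (algebraMap ℤ_[p] (PadicAlgCl p)) with hPA
  set QA := Q'.map (algebraMap ℤ_[q] (PadicAlgCl q)) with hQA
  have hPmonic : P.Monic := hm.monic_prod_pow n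
  have hPAroots : PA.roots = ∑ j, n j • rts p m j := hm.roots_prod_pow n
  set c₀ : ℕ := rootMultiplicity θ₀ QA with hc₀
  set d : J → ℕ := fun j => (m j).natDegree with hd
  have hd0 : ∀ j, 0 < d j := fun j => hm.natDegree_pos j
  -- roots at `p`, minimal polynomials, degrees
  have hex : ∀ j, ∃ θ : PadicAlgCl p, θ ∈ rts p m j := fun j => by
    obtain ⟨θ, hθ⟩ := hm.rts_toFinset_nonempty (p := p) j
    exact ⟨θ, Multiset.mem_toFinset.1 hθ⟩
  choose θ hθ using hex
  set g : J → ℤ_[p][X] := fun j => minpoly ℤ_[p] (θ j) with hg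
  set e : J → ℕ := fun j => (g j).natDegree with he
  have hgmonic : ∀ j, (g j).Monic := fun j => minpoly.monic (hm.isIntegral_of_mem_rts (hθ j))
  have he0 : ∀ j, 0 < e j := fun j => hm.natDegree_minpoly_pos (hθ j)
  set E : ℕ := ∏ j, e j with hE
  have hE0 : 0 < E := Finset.prod_pos fun j _ => he0 j
  -- at `q`
  set g₀ : ℤ_[q][X] := minpoly ℤ_[q] θ₀ with hg₀
  set e₀ : ℕ := g₀.natDegree with he₀
  have hg₀monic : g₀.Monic := minpoly.monic (hm.isIntegral_of_mem_rts hθ₀)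
  have he₀0 : 0 < e₀ := hm.natDegree_minpoly_pos hθ₀
  obtain ⟨hS₀nd, hS₀card, hS₀rts, hS₀aeval, hS₀mult⟩ := hm.minpoly_roots (p := q) hθ₀
  set S₀ := (g₀.map (algebraMap ℤ_[q] (PadicAlgCl q))).roots with hS₀
  -- gluing data and the bound
  obtain ⟨r₀, Cm, ρ, hρ, hglue⟩ := hm.exists_glue
  obtain ⟨Cb, hCb⟩ := hbound r₀
  have hp1 : (1 : ℝ) < p := by exact_mod_cast hp.one_lt
  have hq1 : (1 : ℝ) < q := by exact_mod_cast hq.one_lt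
  -- the decomposition of `N`
  have hNsplit : N = ∑ j ∈ Finset.univ.erase j₀, n j * d j + n j₀ * d j₀ := by
    rw [← hN, ← Finset.add_sum_erase _ _ (Finset.mem_univ j₀), add_comm]
  -- reduce to an inequality of powers of `p`
  suffices key : ∀ k : ℕ, 0 < k →
      (p : ℝ) ^ (k * (E * (∑ j ∈ Finset.univ.erase j₀, n j * d j + c₀ * d j₀))) ≤
        (max Cb 0 * ((Cm : ℝ) * q) ^ N * (q : ℝ) ^ (e₀ * c₀)) * (p : ℝ) ^ (k * (E * N)) by
    have h1 := Nat.le_of_mul_le_mul_left (nat_le_of_forall_pow_le hp1 key) hE0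
    rw [hNsplit] at h1
    exact Nat.le_of_mul_le_mul_right (by omega) (hd0 j₀)
  intro k hk
  set u : ℕ := k * E with hu
  have hdvd : ∀ j, e j ∣ u * d j := fun j =>
    Dvd.dvd.mul_right (Dvd.dvd.mul_left (Finset.dvd_prod_of_mem e (Finset.mem_univ j)) k) _
  set t : J → ℕ := fun j => u * d j / e j with ht
  have hte : ∀ j, t j * e j = u * d j := fun j => Nat.div_mul_cancel (hdvd j)
  -- local test polynomials at `p`
  have hloc : ∀ j, ∃ F : ℤ[X], F ≠ 0 ∧ F.natDegree < d j ∧ height F ≤ p ^ u ∧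
      ∃ H : ℤ_[p][X], F.map (Int.castRingHom ℤ_[p]) %ₘ g j = C ((p : ℤ_[p]) ^ t j) * H := fun j =>
    exists_small_deep (hgmonic j) (he0 j) (hd0 j) (le_of_eq (hte j))
  choose Fj hFj0 hFjdeg hFjht Hj hHj using hloc
  -- the local test polynomial at `q` for `j₀`
  set a : ℕ := p ^ u with ha
  have ha0 : a ≠ 0 := pow_ne_zero _ hp.ne_zero
  set sq : ℕ := Nat.log q a with hsq
  have hqs : q ^ sq ≤ a := Nat.pow_log_le_self q ha0
  have hqs' : a < q ^ (sq + 1) := Nat.lt_pow_succ_log_self hq.one_lt a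
  set t₀ : ℕ := (sq + 1) * d j₀ / e₀ with ht₀
  have ht₀le : t₀ * e₀ ≤ (sq + 1) * d j₀ := Nat.div_mul_le_self _ _
  have ht₀lt : (sq + 1) * d j₀ < t₀ * e₀ + e₀ := Nat.lt_div_mul_add he₀0
  obtain ⟨F₀, hF₀0, hF₀deg, hF₀ht, H₀, hH₀⟩ :=
    exists_small_deep (p := q) hg₀monic he₀0 (hd0 j₀) (u := sq + 1) (t := t₀) ht₀le
  -- the family to glue
  set Fj' : J → ℤ[X] := Function.update Fj j₀ F₀ with hFj'
  have hFj'j₀ : Fj' j₀ = F₀ := Function.update_self _ _ _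
  have hFj'ne : ∀ j, j ≠ j₀ → Fj' j = Fj j := fun j hj => Function.update_of_ne hj _ _
  have hFj'0 : ∀ j, Fj' j ≠ 0 := fun j => by
    by_cases hj : j = j₀
    · subst hj; rw [hFj'j₀]; exact hF₀0
    · rw [hFj'ne j hj]; exact hFj0 j
  have hFj'deg : ∀ j, (Fj' j).natDegree < d j := fun j => by
    by_cases hj : j = j₀
    · subst hj; rw [hFj'j₀]; exact hF₀deg
    · rw [hFj'ne j hj]; exact hFjdeg j
  have hFj'ht : ∀ j, height (Fj' j) ≤ q * p ^ u := fun j => by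
    by_cases hj : j = j₀
    · subst hj; rw [hFj'j₀]
      refine hF₀ht.trans ?_
      rw [pow_succ, mul_comm]
      exact Nat.mul_le_mul_left _ hqs
    · rw [hFj'ne j hj]
      exact (hFjht j).trans (Nat.le_mul_of_pos_left _ hq.pos)
  have hFj'nd : ∀ j, ¬ m j ∣ Fj' j := fun j h =>
    absurd (natDegree_le_of_dvd h (hFj'0 j)) (not_le.2 (hFj'deg j))
  -- glue
  obtain ⟨F, hFdeg, hFht, hFnd, hFeval⟩ := hglue Fj' hFj'deg
  have hFnd' : ∀ j, ¬ m j ∣ F := fun j => hFnd j (hFj'nd j)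
  have hFevalP : ∀ j (b : PadicAlgCl p), aeval b (m j) = 0 → aeval b F = (ρ j : PadicAlgCl p) * aeval b (Fj' j) :=
    fun j b hb => hFeval j (PadicAlgCl p) b hb
  have hFevalQ : ∀ j (b : PadicAlgCl q), aeval b (m j) = 0 → aeval b F = (ρ j : PadicAlgCl q) * aeval b (Fj' j) :=
    fun j b hb => hFeval j (PadicAlgCl q) b hb
  have hFneP : ∀ j, ∀ b ∈ rts p m j, aeval b F ≠ 0 := by
    intro j b hj
    rw [hFevalP j b (hm.mem_rts_iff.1 hj)]
    exact mul_ne_zero (Int.cast_ne_zero.2 (hρ j)) (hm.aeval_ne_zero_of_natDegree_lt hj (hFj'0 j) (hFj'deg j))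
  have hFneQ : ∀ j, ∀ b ∈ rts q m j, aeval b F ≠ 0 := by
    intro j b hj
    rw [hFevalQ j b (hm.mem_rts_iff.1 hj)]
    exact mul_ne_zero (Int.cast_ne_zero.2 (hρ j)) (hm.aeval_ne_zero_of_natDegree_lt hj (hFj'0 j) (hFj'deg j))
  have hFrootP : ∀ b ∈ PA.roots, aeval b F ≠ 0 := by
    intro b hb
    rw [hPAroots, Multiset.mem_sum] at hb
    obtain ⟨j, -, hj⟩ := hb
    exact hFneP j b (Multiset.mem_of_mem_nsmul hj)
  have hFrootQ : ∀ b ∈ QA.roots, aeval b F ≠ 0 := by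
    intro b hb
    obtain ⟨j, hj⟩ := hroots' b hb
    exact hFneQ j b hj
  -- UPPER BOUND
  have hup : kerNorm P F * kerNorm Q' F ≤ (max Cb 0 * ((Cm : ℝ) * q) ^ N) * (p : ℝ) ^ (k * (E * N)) := by
    have h1 := hCb F hFdeg hFnd'
    have hsup : Finset.univ.sup (fun j => height (Fj' j)) ≤ q * p ^ u := Finset.sup_le fun j _ => hFj'ht j
    have hHF : (height F : ℝ) ≤ ((Cm : ℝ) * q) * (p : ℝ) ^ u := by
      have : height F ≤ Cm * (q * p ^ u) := hFht.trans (Nat.mul_le_mul_left _ hsup)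
      have h' : (height F : ℝ) ≤ (Cm : ℝ) * ((q : ℝ) * (p : ℝ) ^ u) := by exact_mod_cast this
      rw [mul_assoc]; exact h'
    calc kerNorm P F * kerNorm Q' F ≤ Cb * (height F : ℝ) ^ N := h1
      _ ≤ max Cb 0 * (height F : ℝ) ^ N := mul_le_mul_of_nonneg_right (le_max_left _ _) (by positivity)
      _ ≤ max Cb 0 * (((Cm : ℝ) * q) * (p : ℝ) ^ u) ^ N :=
          mul_le_mul_of_nonneg_left (pow_le_pow_left₀ (by positivity) hHF N) (le_max_right _ _)
      _ = (max Cb 0 * ((Cm : ℝ) * q) ^ N) * (p : ℝ) ^ (k * (E * N)) := by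
          rw [mul_pow, ← pow_mul, hu]; ring
  -- LOWER BOUND at `p`
  obtain hmr := fun j => hm.minpoly_roots (p := p) (hθ j)
  set S : J → Multiset (PadicAlgCl p) := fun j => ((g j).map (algebraMap ℤ_[p] (PadicAlgCl p))).roots with hS
  have hT : ∑ j ∈ Finset.univ.erase j₀, n j • S j ≤ PA.roots := by
    rw [hPAroots]
    calc ∑ j ∈ Finset.univ.erase j₀, n j • S j ≤ ∑ j ∈ Finset.univ.erase j₀, n j • rts p m j :=
          Finset.sum_le_sum fun j _ => nsmul_le_nsmul_right
            ((Multiset.le_iff_subset (hmr j).1).2 fun b hb => (hmr j).2.2.1 b hb) _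
      _ ≤ ∑ j, n j • rts p m j :=
          Finset.sum_le_sum_of_subset_of_nonneg (Finset.erase_subset _ _) fun j _ _ => Multiset.zero_le _
  have hterm : ∀ j, j ≠ j₀ → ((p : ℝ) ^ (t j)) ^ (e j) ≤ ((S j).map fun b => ‖aeval b F‖⁻¹).prod := by
    intro j hj
    have hcard : Multiset.card (S j) = e j := (hmr j).2.1
    rw [← hcard]
    refine pow_card_le_prod_map (S j) (by positivity) fun b hb => ?_
    have hbF : aeval b F = (ρ j : PadicAlgCl p) * aeval b (Fj' j) :=
      hFevalP j b (hm.mem_rts_iff.1 ((hmr j).2.2.1 b hb))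
    have hle : ‖aeval b F‖ ≤ (p : ℝ) ^ (-(t j : ℤ)) := by
      rw [hbF, norm_mul, hFj'ne j hj]
      calc ‖(ρ j : PadicAlgCl p)‖ * ‖aeval b (Fj j)‖ ≤ 1 * (p : ℝ) ^ (-(t j : ℤ)) :=
            mul_le_mul (norm_intCast_le_one _) (norm_aeval_le_of_modByMonic_eq (hgmonic j) (hHj j)
              ((hmr j).2.2.2.1 b hb)) (norm_nonneg _) zero_le_one
        _ = (p : ℝ) ^ (-(t j : ℤ)) := one_mul _
    have hpos : 0 < ‖aeval b F‖ := norm_pos_iff.2 (hFneP j b ((hmr j).2.2.1 b hb))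
    have h := inv_anti₀ hpos hle
    rwa [zpow_neg, inv_inv, zpow_natCast] at h
  have hexp : ∑ j ∈ Finset.univ.erase j₀, t j * e j * n j = u * ∑ j ∈ Finset.univ.erase j₀, n j * d j := by
    rw [Finset.mul_sum]
    refine Finset.sum_congr rfl fun j _ => ?_
    rw [hte j]; ring
  have hlowP : (p : ℝ) ^ (u * ∑ j ∈ Finset.univ.erase j₀, n j * d j) ≤ kerNorm P F := by
    refine le_trans ?_ (prod_le_kerNorm hPmonic hFrootP hT)
    have hmapsum : Multiset.map (fun b => ‖aeval b F‖⁻¹) (∑ j ∈ Finset.univ.erase j₀, n j • S j) =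
        ∑ j ∈ Finset.univ.erase j₀, Multiset.map (fun b => ‖aeval b F‖⁻¹) (n j • S j) :=
      map_sum (Multiset.mapAddMonoidHom fun b => ‖aeval b F‖⁻¹) _ _
    rw [hmapsum, Multiset.prod_sum]
    simp only [Multiset.map_nsmul, Multiset.prod_nsmul]
    calc (p : ℝ) ^ (u * ∑ j ∈ Finset.univ.erase j₀, n j * d j)
        = ∏ j ∈ Finset.univ.erase j₀, (((p : ℝ) ^ t j) ^ e j) ^ n j := by
          rw [← hexp, ← Finset.prod_pow_eq_pow_sum]
          refine Finset.prod_congr rfl fun j _ => ?_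
          rw [← pow_mul, ← pow_mul, mul_assoc]
      _ ≤ ∏ j ∈ Finset.univ.erase j₀, ((S j).map fun b => ‖aeval b F‖⁻¹).prod ^ n j :=
          Finset.prod_le_prod (fun j _ => by positivity) fun j hj =>
            pow_le_pow_left₀ (by positivity) (hterm j (Finset.ne_of_mem_erase hj)) _
  -- LOWER BOUND at `q`
  have hTq : c₀ • S₀ ≤ QA.roots := by
    rw [Multiset.le_iff_count]
    intro b
    rw [Multiset.count_nsmul]
    by_cases hb : b ∈ S₀
    · rw [Multiset.count_eq_one_of_mem hS₀nd hb, mul_one, count_roots, hS₀mult Q' b hb]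
    · rw [Multiset.count_eq_zero_of_notMem hb, mul_zero]
      exact Nat.zero_le _
  have htermQ : ((q : ℝ) ^ t₀) ^ e₀ ≤ (S₀.map fun b => ‖aeval b F‖⁻¹).prod := by
    have hcard : Multiset.card S₀ = e₀ := hS₀card
    rw [← hcard]
    refine pow_card_le_prod_map S₀ (by positivity) fun b hb => ?_
    have hbF : aeval b F = (ρ j₀ : PadicAlgCl q) * aeval b (Fj' j₀) :=
      hFevalQ j₀ b (hm.mem_rts_iff.1 (hS₀rts b hb))
    have hle : ‖aeval b F‖ ≤ (q : ℝ) ^ (-(t₀ : ℤ)) := by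
      rw [hbF, norm_mul, hFj'j₀]
      calc ‖(ρ j₀ : PadicAlgCl q)‖ * ‖aeval b F₀‖ ≤ 1 * (q : ℝ) ^ (-(t₀ : ℤ)) :=
            mul_le_mul (norm_intCast_le_one _) (norm_aeval_le_of_modByMonic_eq hg₀monic hH₀ (hS₀aeval b hb))
              (norm_nonneg _) zero_le_one
        _ = (q : ℝ) ^ (-(t₀ : ℤ)) := one_mul _
    have hpos : 0 < ‖aeval b F‖ := norm_pos_iff.2 (hFneQ j₀ b (hS₀rts b hb))
    have h := inv_anti₀ hpos hle
    rwa [zpow_neg, inv_inv, zpow_natCast] at h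
  have hlowQ : ((q : ℝ) ^ (t₀ * e₀)) ^ c₀ ≤ kerNorm Q' F := by
    refine le_trans ?_ (prod_le_kerNorm hQ' hFrootQ hTq)
    rw [Multiset.map_nsmul, Multiset.prod_nsmul, pow_mul]
    exact pow_le_pow_left₀ (by positivity) htermQ _
  -- the `q`-adic depth reaches `p^{u d_{j₀}}` up to the constant `q^{e₀}`
  have hqbig : (p : ℝ) ^ (u * d j₀) ≤ (q : ℝ) ^ (t₀ * e₀) * (q : ℝ) ^ e₀ := by
    have h1 : (p : ℝ) ^ (u * d j₀) ≤ ((q : ℝ) ^ (sq + 1)) ^ d j₀ := by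
      rw [pow_mul]
      refine pow_le_pow_left₀ (by positivity) ?_ _
      have : ((p ^ u : ℕ) : ℝ) ≤ ((q ^ (sq + 1) : ℕ) : ℝ) := by exact_mod_cast hqs'.le
      push_cast at this
      exact this
    refine h1.trans ?_
    rw [← pow_mul, ← pow_add]
    exact pow_le_pow_right₀ hq1.le (by omega)
  -- combine
  have hkerP : 0 ≤ kerNorm P F := prod_map_nonneg _ fun b _ => inv_nonneg.2 (norm_nonneg _)
  have hkerQ : 0 ≤ kerNorm Q' F := prod_map_nonneg _ fun b _ => inv_nonneg.2 (norm_nonneg _)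
  calc (p : ℝ) ^ (k * (E * (∑ j ∈ Finset.univ.erase j₀, n j * d j + c₀ * d j₀)))
      = (p : ℝ) ^ (u * ∑ j ∈ Finset.univ.erase j₀, n j * d j) * ((p : ℝ) ^ (u * d j₀)) ^ c₀ := by
        rw [← pow_mul, ← pow_add, hu]; congr 1; ring
    _ ≤ kerNorm P F * ((q : ℝ) ^ (t₀ * e₀) * (q : ℝ) ^ e₀) ^ c₀ :=
        mul_le_mul hlowP (pow_le_pow_left₀ (by positivity) hqbig _) (by positivity) hkerP
    _ = (kerNorm P F * ((q : ℝ) ^ (t₀ * e₀)) ^ c₀) * (q : ℝ) ^ (e₀ * c₀) := by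
        rw [mul_pow, ← pow_mul]; ring
    _ ≤ (kerNorm P F * kerNorm Q' F) * (q : ℝ) ^ (e₀ * c₀) :=
        mul_le_mul_of_nonneg_right (mul_le_mul_of_nonneg_left hlowQ hkerP) (by positivity)
    _ ≤ ((max Cb 0 * ((Cm : ℝ) * q) ^ N) * (p : ℝ) ^ (k * (E * N))) * (q : ℝ) ^ (e₀ * c₀) :=
        mul_le_mul_of_nonneg_right hup (by positivity)
    _ = (max Cb 0 * ((Cm : ℝ) * q) ^ N * (q : ℝ) ^ (e₀ * c₀)) * (p : ℝ) ^ (k * (E * N)) := by ring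

/-- **Rigidity across two primes (equality; `ℓ`-independence).** In the situation of
`rootMultiplicity_le_of_kerNorm_mul_le`, if moreover `deg Q' = ∑ n_j deg m_j`, then `Q' = ∏_j m_j^{n_j}` over
`ℤ_q`: the model at `p` and the polynomial at `q` are the same integer polynomial. [folklore] -/
theorem eq_prod_pow_of_kerNorm_mul_le (n : J → ℕ) {Q' : ℤ_[q][X]} (hQ' : Q'.Monic)
    (hdeg : ∑ j, n j * (m j).natDegree = Q'.natDegree)
    (hroots' : ∀ b ∈ (Q'.map (algebraMap ℤ_[q] (PadicAlgCl q))).roots, ∃ j, b ∈ rts q m j)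
    (hbound : ∀ r : ℕ, ∃ C : ℝ, ∀ F : ℤ[X], F.natDegree < r → (∀ j, ¬ m j ∣ F) →
      kerNorm (∏ j, ((m j).map (algebraMap ℤ ℤ_[p])) ^ n j) F * kerNorm Q' F ≤
        C * (height F : ℝ) ^ Q'.natDegree) :
    Q' = ∏ j, ((m j).map (algebraMap ℤ ℤ_[q])) ^ n j := by
  classical
  set QA := Q'.map (algebraMap ℤ_[q] (PadicAlgCl q)) with hQA
  have hmult : ∀ j, ∀ θ ∈ rts q m j, rootMultiplicity θ QA ≤ n j := fun j θ hθ =>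
    hm.rootMultiplicity_le_of_kerNorm_mul_le (p := p) n hdeg hQ' hroots' hbound j hθ
  have hle : QA.roots ≤ ∑ j, n j • rts q m j := by
    rw [Multiset.le_iff_count]
    intro b
    by_cases hb : b ∈ QA.roots
    · obtain ⟨j, hj⟩ := hroots' b hb
      rw [Multiset.count_sum']
      refine le_trans ?_ (Finset.single_le_sum (f := fun i => Multiset.count b (n i • rts q m i))
        (fun i _ => Nat.zero_le _) (Finset.mem_univ j))
      simp only [Multiset.count_nsmul]
      rw [Multiset.count_eq_one_of_mem (hm.nodup_rts j) hj, mul_one, count_roots]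
      exact hmult j b hj
    · rw [Multiset.count_eq_zero_of_notMem hb]
      exact Nat.zero_le _
  have hcard : Multiset.card (∑ j, n j • rts q m j) ≤ Multiset.card QA.roots := by
    rw [← (IsAlgClosed.splits QA).natDegree_eq_card_roots, hQA, hQ'.natDegree_map, ← hdeg, Multiset.card_sum]
    simp only [Multiset.card_nsmul]
    refine le_of_eq (Finset.sum_congr rfl fun j _ => ?_)
    rw [hm.card_rts]
  exact hm.eq_prod_pow_of_roots_eq hQ' n (Multiset.eq_of_le_of_card_le hle hcard)

end IsGoodFamily

end TwoPrimes


end RootRigidity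

end Literature.Algebra.Polynomial

end
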